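import Literature.Probability.RandomPlanarGeometry.LoewnerMoebiusImageChain
import Literature.Probability.RandomPlanarGeometry.RadialChordalTrace
import Literature.Probability.RandomPlanarGeometry.LoewnerTraceLimit
import Literature.Probability.RandomPlanarGeometry.LoewnerMoebiusLocalisation
import Literature.Probability.RandomPlanarGeometry.LoewnerTraceFunctional
import Literature.Probability.RandomPlanarGeometry.SLETraceGeneralBM
import Literature.Probability.RandomPlanarGeometry.CritPercSLESwallowedProofs
import Literature.Probability.RandomPlanarGeometry.SLESwallowedRealPoints
import Literature.Probability.RandomPlanarGeometry.SLEBoundaryHittingProofs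
import Literature.Probability.RandomPlanarGeometry.RohdeSchrammCor35Proofs
import Literature.Probability.RandomPlanarGeometry.LocalMartingaleProofs
import Literature.Probability.Process.BrownianConcatenation
import Literature.Probability.Process.MartingaleClockTimeChange
import HarnessLib

/-!
# Lawler's locality theorem for SLE₆ in the half-plane: proof of `sle_six_moebius_locality`

Topic `Probability/RandomPlanarGeometry`. We prove the named fact `sle_six_moebius_locality`
(Lawler (2005), §6.3, Thm. 6.13 with Prop. 6.14; `SLESixMoebiusLocality.lean`): for `x ≠ 0`, the
curve class of `Φ_x ∘ γ` stopped at the first hit `T₋` of the ray from the pole `-x`, `γ` the SLE₆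
trace and `Φ_x(z) = xz/(z+x)`, has the same law as the class of `γ` stopped at the first hit `T₊` of
the ray from `x`.

Proof (Lawler's, through the Möbius image chain in capacity time, localised):
* deterministic part (`LoewnerMoebiusClock`, `LoewnerMoebiusImageChain`, `LoewnerMoebiusImageTrace`,
  `SLESixMoebiusIdentification`): with `N = Φ_x = a + b/(p - ·)`, `a = x`, `b = x²`, `p = -x`,
  the hulls `N(K_u)` reparametrised by capacity form the Loewner chain of the image driving
  function `W̃ = A + b d₁/X` with capacity clock `∫ (b d₁/X²)²`, and the image of the trace is the
  trace of the image chain;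
* stochastic part (`LoewnerMoebiusLocalisation`, `SLESixMoebiusMartingale`): localised at the
  two-window time `ρₙ` (gap of the pole in the `n`-th window, image gap in the `n`-th window), the
  image driver stopped at `ρₙ` carries the martingale clock `6 ∫ (b d₁/X²)²` (Itô; the drift is
  `(κ - 6) d₁/X³ = 0` at `κ = 6`); by the Dambis–Dubins–Schwarz time change
  (`HasMartingaleClock.timeChange`) and concatenation with an independent Brownian motion
  (`isBrownianReal_concat`) there is, on the product of two Wiener spaces, a Brownian motion `B̃`
  with `√6 B̃` equal to the image driver in capacity time up to the total clock of `ρₙ`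
  (`exists_imageBM`);
* identification: the chain of `√6 B̃` is a.s. generated by a curve (Rohde–Schramm for a general
  Brownian motion, `ae_isGeneratedByCurve_of_isBrownianReal`), which is `N ∘ γ` in capacity time
  (`stopClass_moebius_eq`); the localisation time is the SAME path functional of the image driver
  with the windows swapped (`locTime_image_eq`), and `√6 B̃` has the path law of `√6 B`
  (`map_eq_map_drivingPath`), so the class of `N ∘ γ` stopped at `ρₙ` has the law of the class of
  `γ` stopped at the swapped localisation time `ρₙ'`;
* limit: `ρₙ → T_{-x} = T₋` and `ρₙ' → T_x = T₊` a.s. (`tendsto_untopD_locTime_win`, finiteness of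
  swallowing times for `κ = 6 > 4`, `sle_swallowingTime_ofReal_eq_firstHit`), the classes converge
  (`tendsto_stopClass`), and laws of a.s. limits of identically distributed sequences agree
  (`measure_setOf_mem_eq_of_tendsto_ae`).

## References

* G. F. Lawler, *Conformally Invariant Processes in the Plane*, AMS (2005), §4.6.1, §6.3 Thm. 6.13,
  Prop. 6.14. [Lawler2005]
* D. Revuz, M. Yor, *Continuous Martingales and Brownian Motion* (1999), Ch. V Thm. (1.6)–(1.7).
  [RevuzYor1999]
-/

/-!
## Part A. The Möbius image of a chordal Loewner trace is the trace of the image chain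

Topic `Probability/RandomPlanarGeometry`. Sequel of `LoewnerMoebiusImageChain` (G. F. Lawler,
*Conformally Invariant Processes in the Plane* (2005), §6.3, Thm. 6.13 / Prop. 6.14: "`γ*` is a
time change of an SLE₆ curve", the deterministic part). There the image hulls `N(K_u)` of the
chordal Loewner chain of `W` under the Möbius map `N(z) = a + b/(p - z)` were identified, at the
capacity times `clock u` (`u < u₁ < T_p`), with the hulls of the chain driven by the image driver
`U = imageDriver` (and the image maps with `h_u ∘ g_u ∘ N⁻¹`). Here we pass to GENERATING CURVES:

* `hull_eq_image_of_eqOn`, `invFunOn_map_imageDriver` — the hull identity and the inverse image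
  map `(g^U_{clock u})⁻¹ = N ∘ g_u⁻¹ ∘ h_u⁻¹` on `ℍ`, also for any continuous driving function
  `U'` agreeing with `U` up to `clock u₂` (locality of the chain in the driver,
  `Loewner.domain_eq_of_eqOn`, `Loewner.invFunOn_map_eq_of_eqOn`);
* `conjMapInv_driver`, `tendsto_conjMapInv_driver` — `h_u⁻¹(W̃_u) = W_u`, and `h_u⁻¹ → W_u`
  within `ℍ` at `W̃_u`;
* **`apply_clockNN_eq_of_isGeneratedByCurve`** — if the chain of `W` is generated by `γ` and
  the chain of such a `U'` is generated by `γ̂`, then `γ̂ (clock u) = N(γ u)` for `u ≤ u₂`,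
  provided `γ` avoids the pole on `[0, u₂]` (the tip of a generated chain is the limit of the
  inverse map at the driving point within `ℍ`, `IsGeneratedByCurve.tendsto_invFunOn_map`,
  Lawler Prop. 4.31 / Rem. 4.32, and the two inverse maps are intertwined by `N` and `h_u⁻¹`).

This is the pathwise content of "the image curve, parametrised by capacity, is the curve of the
image chain"; the probability (that `U'` is `√6 ×` a Brownian motion whose chain is generated by
a curve) is elsewhere.

## References

* G. F. Lawler, *Conformally Invariant Processes in the Plane*, AMS (2005), §4.4 (Prop. 4.31,
  Rem. 4.32), §6.3 (Thm. 6.13, Prop. 6.14). [Lawler2005]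
-/

noncomputable section

open Set Filter Topology Complex
open UpperHalfPlane (upperHalfPlaneSet)
open scoped NNReal

namespace Literature.Probability.RandomPlanarGeometry

namespace MoebiusPole

open Loewner

variable {W : ℝ≥0 → ℝ} {p : ℝ} {u₁ : ℝ≥0} {a b : ℝ}

/-! ### The inverse conjugating map at the image driving value -/

/-- `N` is continuous off the pole. [folklore] -/
theorem continuousAt_moebN {z : ℂ} (hz : z ≠ p) : ContinuousAt (moebN a b p) z := by
  unfold moebN
  exact continuousAt_const.add (continuousAt_const.div (continuousAt_const.sub continuousAt_id)
    (sub_ne_zero.2 (Ne.symm hz)))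

/-- `h_u⁻¹` is continuous off the far value `A_u`. [folklore] -/
theorem continuousAt_conjMapInv (u : ℝ) {w : ℂ} (hw : w ≠ farPoint a b (gap W p u₁) u) :
    ContinuousAt (conjMapInv W p u₁ a b u) w := by
  unfold conjMapInv
  exact continuousAt_const.sub (continuousAt_const.div (continuousAt_id.sub continuousAt_const)
    (sub_ne_zero.2 hw))

variable (hW : Continuous W) (hp : p ≠ W 0) (hu₁ : (u₁ : WithTop ℝ≥0) < swallowingTime W p)
  (hb : 0 < b)
include hW hp hu₁ hb

/-- The image driving value is not the far value: `W̃_u - A_u = b d₁/X_u ≠ 0`. [folklore] -/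
theorem driver_ne_farPoint (u : ℝ) :
    ((driver a b (gap W p u₁) u : ℝ) : ℂ) ≠ farPoint a b (gap W p u₁) u := by
  intro h
  have h1 := farPoint_sub_driver (a := a) (b := b) (X := gap W p u₁) u
  rw [ofReal_injective h, sub_self] at h1
  exact (neg_ne_zero.2 (div_ne_zero (mul_ne_zero hb.ne' (poleDeriv_pos u).ne')
    (gap_ne_zero hW hp hu₁ u))) h1.symm

/-- **`h_u⁻¹(W̃_u) = W_u`** on `[0, u₁]` (`h_u⁻¹(w) = P - b d₁/(w - A)`, `W̃ - A = b d₁/X`,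
`P - X = W`). [folklore] -/
theorem conjMapInv_driver {u : ℝ} (hu : u ∈ Icc (0 : ℝ) u₁) :
    conjMapInv W p u₁ a b u (driver a b (gap W p u₁) u) = W u.toNNReal := by
  rw [← poleFlow_gap_sub_gap hW hp hu₁ hu, conjMapInv]
  have h1r : driver a b (gap W p u₁) u - farPoint a b (gap W p u₁) u =
      b * poleDeriv (gap W p u₁) u / gap W p u₁ u := by
    have := farPoint_sub_driver (a := a) (b := b) (X := gap W p u₁) u
    linarith
  have h1 : ((driver a b (gap W p u₁) u : ℝ) : ℂ) - farPoint a b (gap W p u₁) u =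
      ((b * poleDeriv (gap W p u₁) u / gap W p u₁ u : ℝ) : ℂ) := by
    rw [← ofReal_sub, h1r]
  rw [h1]
  have hX : (gap W p u₁ u : ℂ) ≠ 0 := ofReal_ne_zero.2 (gap_ne_zero hW hp hu₁ u)
  have hb' : (b : ℂ) ≠ 0 := ofReal_ne_zero.2 hb.ne'
  have hd : (poleDeriv (gap W p u₁) u : ℂ) ≠ 0 := ofReal_ne_zero.2 (poleDeriv_pos u).ne'
  push_cast
  field_simp

/-- **`h_u⁻¹ → W_u` within `ℍ` at `W̃_u`** (`u ∈ [0, u₁]`). [folklore] -/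
theorem tendsto_conjMapInv_driver {u : ℝ} (hu : u ∈ Icc (0 : ℝ) u₁) :
    Tendsto (conjMapInv W p u₁ a b u) (𝓝[upperHalfPlaneSet] (driver a b (gap W p u₁) u : ℂ))
      (𝓝[upperHalfPlaneSet] (W u.toNNReal : ℂ)) := by
  have hc : ContinuousWithinAt (conjMapInv W p u₁ a b u) upperHalfPlaneSet
      (driver a b (gap W p u₁) u : ℂ) :=
    (continuousAt_conjMapInv u (driver_ne_farPoint (a := a) hW hp hu₁ hb u)).continuousWithinAt
  have hmaps : MapsTo (conjMapInv W p u₁ a b u) upperHalfPlaneSet upperHalfPlaneSet :=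
    fun w hw ↦ im_conjMapInv_pos (W := W) (p := p) (u₁ := u₁) (a := a) hb u hw
  have h := hc.tendsto_nhdsWithin hmaps
  rwa [conjMapInv_driver hW hp hu₁ hb hu] at h

/-! ### The inverse image map and the hulls, also for an agreeing driver -/

/-- **The inverse image Loewner map through the original one**: for `u < u₁` and `w ∈ ℍ`,
`(g^U_{clock u})⁻¹(w) = N(g_u⁻¹(h_u⁻¹ w))`, the inverses read as `Function.invFunOn` on the
Loewner domains. [cite: Lawler2005, §6.3] -/
theorem invFunOn_map_imageDriver {u : ℝ≥0} (hu : u < u₁) {w : ℂ} (hw : w ∈ upperHalfPlaneSet) :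
    Function.invFunOn (map (imageDriver W p u₁ a b) (clockNN W p u₁ b u))
        (domain (imageDriver W p u₁ a b) (clockNN W p u₁ b u)) w =
      moebN a b p (Function.invFunOn (map W u) (domain W u) (conjMapInv W p u₁ a b u w)) := by
  have hUc := continuous_imageDriver (a := a) hW hp hu₁ hb
  have hyH : conjMapInv W p u₁ a b u w ∈ upperHalfPlaneSet := im_conjMapInv_pos hb u hw
  set z := Function.invFunOn (map W u) (domain W u) (conjMapInv W p u₁ a b u w) with hzdef
  have hex : ∃ z' ∈ domain W u, map W u z' = conjMapInv W p u₁ a b u w := (surjOn_map hW u) hyH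
  have hzdom : z ∈ domain W u := Function.invFunOn_mem hex
  have hzeq : map W u z = conjMapInv W p u₁ a b u w := Function.invFunOn_eq hex
  obtain ⟨hmem, hmap⟩ := map_imageDriver_apply hW hp hu₁ hb hu hzdom
  have hne : w ≠ farPoint a b (gap W p u₁) u := fun h ↦ by
    have := congrArg Complex.im h
    rw [ofReal_im] at this
    exact (show 0 < w.im from hw).ne' this
  rw [hzeq, conjMap_conjMapInv hb.ne' u hne] at hmap
  have hex' : ∃ z' ∈ domain (imageDriver W p u₁ a b) (clockNN W p u₁ b u),
      map (imageDriver W p u₁ a b) (clockNN W p u₁ b u) z' = w := ⟨moebN a b p z, hmem, hmap⟩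
  exact (injOn_map hUc _) (Function.invFunOn_mem hex') hmem
    ((Function.invFunOn_eq hex').trans hmap.symm)

variable {U' : ℝ≥0 → ℝ} (hU' : Continuous U') {u₂ : ℝ≥0} (hu₂ : u₂ < u₁)
  (hagree : ∀ s, s ≤ clockNN W p u₁ b u₂ → U' s = imageDriver W p u₁ a b s)
include hU' hu₂ hagree

omit hU' in
/-- Agreement up to `clock u₂` gives agreement up to `clock u` for `u ≤ u₂`. [folklore] -/
theorem eqOn_of_le {u : ℝ≥0} (hu : u ≤ u₂) :
    ∀ s, s ≤ clockNN W p u₁ b u → imageDriver W p u₁ a b s = U' s := fun s hs ↦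
  (hagree s (hs.trans (by
    rcases hu.eq_or_lt with rfl | hlt
    · exact le_rfl
    · exact (clockNN_lt_clockNN hW hp hu₁ hb hlt).le))).symm

/-- **The hulls of an agreeing driver are the image hulls**: for `u ≤ u₂`,
`K^{U'}_{clock u} = N(K_u)`. [cite: Lawler2005, §6.3 Thm. 6.13] -/
theorem hull_eq_image_of_eqOn {u : ℝ≥0} (hu : u ≤ u₂) :
    hull U' (clockNN W p u₁ b u) = moebN a b p '' hull W u := by
  have hUc := continuous_imageDriver (a := a) hW hp hu₁ hb
  have hdom := Loewner.domain_eq_of_eqOn hUc hU' (eqOn_of_le hW hp hu₁ hb hu₂ hagree hu)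
  have h1 : hull U' (clockNN W p u₁ b u) = hull (imageDriver W p u₁ a b) (clockNN W p u₁ b u) := by
    rw [← Set.sdiff_sdiff_cancel_left (hull_subset U' (clockNN W p u₁ b u)),
      ← Set.sdiff_sdiff_cancel_left (hull_subset (imageDriver W p u₁ a b) (clockNN W p u₁ b u))]
    exact congrArg (upperHalfPlaneSet \ ·) hdom
  rw [h1, hull_imageDriver_eq hW hp hu₁ hb (lt_of_le_of_lt hu hu₂)]

/-- **The Möbius image of the trace is the trace of the image chain.** Let the chain of `W` be
generated by `γ` and the chain of `U'` (continuous, equal to the image driver up to `clock u₂`,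
`u₂ < u₁`) by `γ̂`, and let `γ` avoid the pole on `[0, u₂]`. Then `γ̂ (clock u) = N(γ u)` for every
`u ≤ u₂`: both tips are limits of the inverse maps at the driving values within `ℍ`
(`IsGeneratedByCurve.tendsto_invFunOn_map`), the inverse maps are intertwined by `N` and `h_u⁻¹`
(`invFunOn_map_imageDriver`, `Loewner.invFunOn_map_eq_of_eqOn`), and `h_u⁻¹ → W_u` within `ℍ`
at `U'_{clock u} = W̃_u` (`tendsto_conjMapInv_driver`). Lawler §6.3: "`γ̃*(t) := γ*(r(t))` is
parametrized by capacity … `γ*` is a time change of an SLE₆ curve" (pathwise part).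
[cite: Lawler2005, §6.3 Thm. 6.13] -/
theorem apply_clockNN_eq_of_isGeneratedByCurve {γ γ' : ℝ≥0 → ℂ} (hγ : IsGeneratedByCurve W γ)
    (hγ' : IsGeneratedByCurve U' γ') (hpole : ∀ u : ℝ≥0, u ≤ u₂ → γ u ≠ p) {u : ℝ≥0}
    (hu : u ≤ u₂) : γ' (clockNN W p u₁ b u) = moebN a b p (γ u) := by
  have hUc := continuous_imageDriver (a := a) hW hp hu₁ hb
  have huu₁ : u < u₁ := lt_of_le_of_lt hu hu₂
  have humem : (u : ℝ) ∈ Icc (0 : ℝ) u₁ := ⟨u.coe_nonneg, NNReal.coe_le_coe.2 huu₁.le⟩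
  set s := clockNN W p u₁ b u with hs
  have heq := eqOn_of_le hW hp hu₁ hb hu₂ hagree hu
  -- the driving value of `U'` at `s` is `W̃_u`
  have hUs : U' s = driver a b (gap W p u₁) u := by
    rw [← heq s le_rfl, hs, imageDriver_clockNN hW hp hu₁ hb huu₁.le]
  -- tip of the `U'`-chain at `s`
  have htip' := hγ'.tendsto_invFunOn_map hU' s
  rw [hUs] at htip'
  -- the inverse `U'`-map is the inverse image map, which is `N ∘ g_u⁻¹ ∘ h_u⁻¹` on `ℍ`
  have hev : ∀ w ∈ upperHalfPlaneSet, Function.invFunOn (map U' s) (domain U' s) w =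
      moebN a b p (Function.invFunOn (map W u) (domain W u) (conjMapInv W p u₁ a b u w)) := by
    intro w hw
    rw [Loewner.invFunOn_map_eq_of_eqOn hUc hU' heq hw, invFunOn_map_imageDriver hW hp hu₁ hb huu₁ hw]
  -- the composite limit
  have hlim : Tendsto (fun w ↦ moebN a b p (Function.invFunOn (map W u) (domain W u)
      (conjMapInv W p u₁ a b u w))) (𝓝[upperHalfPlaneSet] (driver a b (gap W p u₁) u : ℂ))
      (𝓝 (moebN a b p (γ u))) := by
    have h1 := tendsto_conjMapInv_driver (a := a) hW hp hu₁ hb humem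
    rw [Real.toNNReal_coe] at h1
    have h2 := (hγ.tendsto_invFunOn_map hW u).comp h1
    exact ((continuousAt_moebN (a := a) (b := b) (hpole u hu)).tendsto).comp h2
  have hlim' : Tendsto (Function.invFunOn (map U' s) (domain U' s))
      (𝓝[upperHalfPlaneSet] (driver a b (gap W p u₁) u : ℂ)) (𝓝 (moebN a b p (γ u))) :=
    hlim.congr' (eventually_nhdsWithin_of_forall fun w hw ↦ (hev w hw).symm)
  haveI : (𝓝[upperHalfPlaneSet] ((driver a b (gap W p u₁) u : ℝ) : ℂ)).NeBot :=
    mem_closure_iff_nhdsWithin_neBot.1 (mem_closure_upperHalfPlaneSet_iff.2 (by rw [ofReal_im]))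
  exact tendsto_nhds_unique htip' hlim'

/-- **The image curve avoids the tracked ray strictly before the horizon**, in the form needed
downstream: for `u ≤ u₂`, `γ̂ (clock u) ≠ a` (`N(z) = a` only at `z = ∞`). [folklore] -/
theorem apply_clockNN_ne_far {γ γ' : ℝ≥0 → ℂ} (hγ : IsGeneratedByCurve W γ)
    (hγ' : IsGeneratedByCurve U' γ') (hpole : ∀ u : ℝ≥0, u ≤ u₂ → γ u ≠ p) {u : ℝ≥0}
    (hu : u ≤ u₂) : γ' (clockNN W p u₁ b u) ≠ a := by
  rw [apply_clockNN_eq_of_isGeneratedByCurve hW hp hu₁ hb hU' hu₂ hagree hγ hγ' hpole hu, moebN]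
  intro h
  have h1 : (b : ℂ) / ((p : ℂ) - γ u) = 0 := by
    have := congrArg (· - (a : ℂ)) h
    simpa using this
  rw [div_eq_zero_iff] at h1
  rcases h1 with h1 | h1
  · exact hb.ne' (ofReal_eq_zero.1 h1)
  · exact hpole u hu (sub_eq_zero.1 h1).symm

end MoebiusPole

end Literature.Probability.RandomPlanarGeometry

end

/-!
## Part B. The Möbius image of a Loewner trace, stopped at the localisation time: deterministic identification

Topic `Probability/RandomPlanarGeometry`. Pathwise part of Lawler's locality theorem for SLE₆
(Lawler (2005), §6.3, Thm. 6.13 / Prop. 6.14; tree `sle_six_moebius_locality`), for the Möbius map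
`N(z) = a + b/(p - z)` and the localisation `ρ = locTime` of `LoewnerMoebiusLocalisation`
(windows `(l₁, h₁)` for the gap of the pole `p`, `(l₂, h₂)` for the image gap), given a driving
function `U` that AGREES with the image driver `imageDriver W p ρ a b` (image driving function in
capacity time, `LoewnerMoebiusImageChain`) up to the total clock `clock ρ`:

* `apply_clockNN_eq_all` — the generating curves satisfy `γ̂ (clock u) = N(γ u)` for all `u ≤ ρ`
  (from `apply_clockNN_eq_of_isGeneratedByCurve`, extended to `u = ρ` by continuity);
* `stopClass_moebius_eq` — hence **the class of `N ∘ γ` stopped at `ρ` is the class of `γ̂` stopped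
  at `clock ρ`** (two monotone traversals of one arc, `Curve.reparamDist_eq_zero_of_monotone'`);
* `locTime_image_eq_clockNN` — **the localisation time is intrinsic to the image**: the same
  functional `locTime`, read on `U` with the pole `a = N(∞)` and the two windows SWAPPED, returns
  exactly `clock ρ` (the dictionary `X̂_s = -b d₁(υ s)/X_{υ s}`, `d̂₁(s) = d₁(υ s)`,
  `-b d̂₁/X̂ = X ∘ υ` of `LoewnerMoebiusImageChain` / `LoewnerMoebiusClock`, and exit times
  correspond under the time change);
* `tendsto_locTime_atTop` — as the windows exhaust `(0, ∞)`/`(-∞, 0)`, the localisation times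
  increase to the swallowing time of the pole.

## References

* G. F. Lawler, *Conformally Invariant Processes in the Plane*, AMS (2005), §4.6.1, §6.3.
  [Lawler2005]
-/

noncomputable section

open MeasureTheory Filter Set
open scoped NNReal ENNReal Topology unitInterval

namespace Literature.Probability.RandomPlanarGeometry

namespace MoebiusPole

open Loewner Literature.Probability.Process Literature.Analysis.FunctionSpaces

/-! ### The image curve on the whole localised interval -/

section ClassIdentity

variable {W : ℝ≥0 → ℝ} {p a b : ℝ} {u₁ : ℝ≥0}
variable (hW : Continuous W) (hp : p ≠ W 0) (hu₁ : (u₁ : WithTop ℝ≥0) < swallowingTime W p)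
  (hb : 0 < b)
include hW hp hu₁ hb

/-- `clockNN` at `0` is `0`. [folklore] -/
theorem clockNN_zero : clockNN W p u₁ b 0 = 0 := by
  apply NNReal.eq
  rw [coe_clockNN hW hp hu₁ hb, NNReal.coe_zero]
  exact clock_zero

/-- `clockNN` is monotone. [folklore] -/
theorem clockNN_mono {u u' : ℝ≥0} (h : u ≤ u') : clockNN W p u₁ b u ≤ clockNN W p u₁ b u' := by
  rcases h.eq_or_lt with rfl | hlt
  · exact le_rfl
  · exact (clockNN_lt_clockNN hW hp hu₁ hb hlt).le

omit hb in
/-- `u ↦ clockNN u` is continuous. [folklore] -/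
theorem continuous_clockNN : Continuous fun u : ℝ≥0 ↦ clockNN W p u₁ b u := by
  have hX := continuous_gap (u₁ := u₁) hW hp
  have hX0 := gap_ne_zero hW hp hu₁
  have h1 : Continuous fun u : ℝ≥0 ↦ clock b (gap W p u₁) u :=
    (continuous_clock hX hX0).comp NNReal.continuous_coe
  exact continuous_real_toNNReal.comp h1

/-- **`γ̂ (clock u) = N(γ u)` for all `u ≤ u₁`** (agreement of the driver up to the total clock
`clock u₁`; the pole is never on `γ`). [cite: Lawler2005, §6.3 Thm. 6.13] -/
theorem apply_clockNN_eq_all {U : ℝ≥0 → ℝ} (hU : Continuous U)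
    (hagree : ∀ s, s ≤ clockNN W p u₁ b u₁ → U s = imageDriver W p u₁ a b s)
    {γ γ' : ℝ≥0 → ℂ} (hγ : IsGeneratedByCurve W γ) (hγ' : IsGeneratedByCurve U γ')
    (hpole : ∀ u : ℝ≥0, γ u ≠ p) {u : ℝ≥0} (hu : u ≤ u₁) :
    γ' (clockNN W p u₁ b u) = moebN a b p (γ u) := by
  -- strictly before the horizon: the local statement with `u₂ = u`
  have hlt : ∀ u, u < u₁ → γ' (clockNN W p u₁ b u) = moebN a b p (γ u) := fun u hu' ↦
    apply_clockNN_eq_of_isGeneratedByCurve hW hp hu₁ hb hU hu'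
      (fun s hs ↦ hagree s (hs.trans (clockNN_mono hW hp hu₁ hb hu'.le))) hγ hγ'
      (fun v _ ↦ hpole v) le_rfl
  -- at the horizon: `u₁ = 0` directly, else by continuity from the left
  have key : γ' (clockNN W p u₁ b u₁) = moebN a b p (γ u₁) := by
    rcases eq_or_ne u₁ 0 with h0 | hne
    · have h00 : clockNN W p u₁ b u₁ = 0 := by
        conv_lhs => arg 5; rw [h0]
        exact clockNN_zero hW hp hu₁ hb
      rw [h00, hγ'.apply_zero, h0, hγ.apply_zero, hagree 0 bot_le,
        imageDriver_zero hW hp hu₁ hb, moebN]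
      push_cast
      ring
    · have hpos : 0 < u₁ := pos_iff_ne_zero.2 hne
      haveI : (𝓝[<] u₁).NeBot := nhdsLT_neBot_of_exists_lt ⟨0, hpos⟩
      have hf : Tendsto (fun v ↦ γ' (clockNN W p u₁ b v)) (𝓝[<] u₁)
          (𝓝 (γ' (clockNN W p u₁ b u₁))) :=
        ((hγ'.continuous.comp (continuous_clockNN hW hp hu₁ (b := b))).tendsto u₁).mono_left
          nhdsWithin_le_nhds
      have hg : Tendsto (fun v ↦ moebN a b p (γ v)) (𝓝[<] u₁) (𝓝 (moebN a b p (γ u₁))) :=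
        (((continuousAt_moebN (a := a) (b := b) (hpole u₁)).tendsto).comp
          (hγ.continuous.tendsto u₁)).mono_left nhdsWithin_le_nhds
      have heq : (fun v ↦ γ' (clockNN W p u₁ b v)) =ᶠ[𝓝[<] u₁] fun v ↦ moebN a b p (γ v) := by
        filter_upwards [self_mem_nhdsWithin] with v hv
        exact hlt v hv
      exact tendsto_nhds_unique (hf.congr' heq) hg
  rcases hu.lt_or_eq with h | rfl
  · exact hlt u h
  · exact key

/-- A real level `r ∈ [0, clock u₁]` is the clock of `υ r ∈ [0, u₁]`, in `ℝ≥0`. [folklore] -/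
theorem clockNN_invClock_toNNReal {r : ℝ} (hr : r ∈ Icc 0 (clock b (gap W p u₁) u₁)) :
    clockNN W p u₁ b (invClock b (gap W p u₁) u₁ r).toNNReal = r.toNNReal := by
  have hX := continuous_gap (u₁ := u₁) hW hp
  have hX0 := gap_ne_zero hW hp hu₁
  have hυ := invClock_mem_Icc hX hX0 hb.ne' u₁.coe_nonneg hr
  apply NNReal.eq
  rw [coe_clockNN hW hp hu₁ hb, Real.coe_toNNReal _ hυ.1, Real.coe_toNNReal _ hr.1,
    clock_invClock_of_mem hX hX0 hb.ne' u₁.coe_nonneg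
      (Ioo_subset_Icc_self (Icc_subset_Ioo_clock hX hX0 hb.ne' hr))]

/-- **The class of `N ∘ γ` stopped at `u₁` is the class of the image curve stopped at the total
clock `clock u₁`** (two monotone traversals `s ↦ u₁ s` and `s ↦ υ(clock(u₁) s)` of the same arc).
[cite: Lawler2005, §6.3 Thm. 6.13] -/
theorem stopClass_moebius_eq {U : ℝ≥0 → ℝ} (hU : Continuous U)
    (hagree : ∀ s, s ≤ clockNN W p u₁ b u₁ → U s = imageDriver W p u₁ a b s)
    {γ γ' : ℝ≥0 → ℂ} (hγ : IsGeneratedByCurve W γ) (hγ' : IsGeneratedByCurve U γ')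
    (hpole : ∀ u : ℝ≥0, γ u ≠ p) (Nγ : C(ℝ≥0, ℂ)) (hNγ : ∀ t, moebN a b p (γ t) = Nγ t)
    (γc : C(ℝ≥0, ℂ)) (hγc : ∀ t, γc t = γ' t) :
    stopClass Nγ u₁ = stopClass γc (clockNN W p u₁ b u₁) := by
  have hX := continuous_gap (u₁ := u₁) hW hp
  have hX0 := gap_ne_zero hW hp hu₁
  have hb0 := hb.ne'
  set σ₀ : ℝ := clock b (gap W p u₁) u₁ with hσ₀
  have hσ₀nn : 0 ≤ σ₀ := clock_nonneg hX hX0 hb0 u₁.coe_nonneg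
  have hσ₀coe : ((clockNN W p u₁ b u₁ : ℝ≥0) : ℝ) = σ₀ := coe_clockNN hW hp hu₁ hb u₁
  rw [stopClass, stopClass, CurveClass.mk_eq_mk]
  -- two monotone traversals of `V r = N(γ r⁺)` on `[0, u₁]`
  set q : ℝ → ℝ := fun r ↦ max 0 (min 1 r) with hq
  have hq01 : ∀ r, q r ∈ Icc (0 : ℝ) 1 := fun r ↦ ⟨le_max_left _ _, max_le zero_le_one (min_le_left _ _)⟩
  set h₁ : ℝ → ℝ := fun r ↦ (u₁ : ℝ) * q r with hh₁
  set h₂ : ℝ → ℝ := fun r ↦ invClock b (gap W p u₁) u₁ (σ₀ * q r) with hh₂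
  have hmemσ : ∀ r, σ₀ * q r ∈ Icc 0 σ₀ := fun r ↦
    ⟨mul_nonneg hσ₀nn (hq01 r).1, mul_le_of_le_one_right hσ₀nn (hq01 r).2⟩
  refine Curve.reparamDist_eq_zero_of_monotone' (m := (u₁ : ℝ)) u₁.coe_nonneg
    (V := fun r ↦ Nγ r.toNNReal) ?_ (h₁ := h₁) (h₂ := h₂) ?_ ?_ ?_ ?_ ?_ ?_ ?_ ?_ ?_ ?_
  · exact (Nγ.continuous.comp continuous_real_toNNReal).continuousOn
  · exact continuous_const.mul continuous_clampUnit
  · exact (continuous_invClock hX hX0 hb0 u₁.coe_nonneg).comp (continuous_const.mul continuous_clampUnit)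
  · exact fun r r' hrr' ↦ mul_le_mul_of_nonneg_left (monotone_clampUnit hrr') u₁.coe_nonneg
  · exact fun r r' hrr' ↦ monotone_invClock hX hX0 hb0 u₁.coe_nonneg
      (mul_le_mul_of_nonneg_left (monotone_clampUnit hrr') hσ₀nn)
  · simp [hh₁, hq]
  · simp only [hh₂, hq]
    rw [min_eq_right zero_le_one, max_self, mul_zero, invClock_zero hX hX0 hb0 u₁.coe_nonneg]
  · simp only [hh₁, hq]
    rw [min_self, max_eq_right zero_le_one, mul_one]
  · simp only [hh₂, hq]
    rw [min_self, max_eq_right zero_le_one, mul_one, hσ₀,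
      invClock_clock hX hX0 hb0 u₁.coe_nonneg ⟨by linarith [u₁.coe_nonneg], by linarith⟩]
  · intro t
    show Nγ (((u₁ : ℝ) * t).toNNReal) = Nγ (h₁ t).toNNReal
    simp only [hh₁, hq, clampUnit_of_mem t]
  · -- the image curve read at `σ₀ t` is `N(γ(υ(σ₀ t)))`
    intro t
    show γc (((clockNN W p u₁ b u₁ : ℝ) * t).toNNReal) = Nγ (h₂ t).toNNReal
    simp only [hh₂, hq, clampUnit_of_mem t, hσ₀coe]
    have hr := hmemσ t
    simp only [hq, clampUnit_of_mem t] at hr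
    have hυ := invClock_mem_Icc hX hX0 hb0 u₁.coe_nonneg hr
    have hle : (invClock b (gap W p u₁) u₁ (σ₀ * t)).toNNReal ≤ u₁ := by
      have := Real.toNNReal_le_toNNReal hυ.2
      rwa [Real.toNNReal_coe] at this
    rw [← clockNN_invClock_toNNReal hW hp hu₁ hb hr, hγc,
      apply_clockNN_eq_all hW hp hu₁ hb hU hagree hγ hγ' hpole hle, hNγ]

end ClassIdentity

/-! ### The localisation time read on the image -/

section LocIdentity

variable {Ω Ω' : Type*} {W : Ω → ℝ≥0 → ℝ} {U : Ω' → ℝ≥0 → ℝ} {ω : Ω} {ω' : Ω'}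
  {p a b l₁ h₁ l₂ h₂ : ℝ} {ρ₀ : ℝ≥0} {τ : Ω → WithTop ℝ≥0}

/-- `(r ∧ c)⁺ = r⁺ ∧ c`. [folklore] -/
theorem toNNReal_min_coe (r : ℝ) (c : ℝ≥0) : (min r (c : ℝ)).toNNReal = min r.toNNReal c := by
  rcases le_total r c with h | h
  · rw [min_eq_left h, min_eq_left (Real.toNNReal_le_iff_le_coe.2 h)]
  · rw [min_eq_right h, Real.toNNReal_coe, min_eq_right]
    have := Real.toNNReal_le_toNNReal h
    rwa [Real.toNNReal_coe] at this

/-- **The stopped gap path at a sample where `τ = ρ₀` is the clamped gap `gap (W ω) p ρ₀`.**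
[folklore] -/
theorem gapPath_eq_gap (hτ : τ ω = ρ₀) : gapPath W p τ ω = gap (W ω) p ρ₀ := by
  funext r
  rw [gapPath_apply, gapStop_apply, hτ, untopA_min_coe_coe, gap, toNNReal_min_coe]
  rfl

variable (hWc : Continuous (W ω)) (hW0 : W ω 0 = 0) (h : LocGood p b l₁ h₁ l₂ h₂)
  (hρ : locTime W p b l₁ h₁ l₂ h₂ ω = ρ₀)
include hWc hW0 h hρ

/-- `ρ₀ < T_p`. [folklore] -/
theorem coe_rho_lt_swallowingTime : (ρ₀ : WithTop ℝ≥0) < swallowingTime (W ω) p :=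
  coe_lt_swallowingTime_of_le_locTime hWc hW0 h.hq h.h0 hρ.symm.le

omit hWc hW0 h in
/-- The original image gap at `u ≤ ρ₀`, in terms of the clamped gap. [folklore] -/
theorem imgGapProc_locTime_of_le {u : ℝ≥0} (hu : u ≤ ρ₀) :
    imgGapProc W p (locTime W p b l₁ h₁ l₂ h₂) b u ω =
      -(b * poleDeriv (gap (W ω) p ρ₀) u / gap (W ω) p ρ₀ u) := by
  have hle : (u : WithTop ℝ≥0) ≤ locTime W p b l₁ h₁ l₂ h₂ ω := by
    rw [hρ]; exact WithTop.coe_le_coe.2 hu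
  rw [imgGapProc_eq, stopT_of_le hle, gapPath_eq_gap hρ]

variable (hUc : Continuous (U ω'))
  (hagree : ∀ s, s ≤ clockNN (W ω) p ρ₀ b ρ₀ → U ω' s = imageDriver (W ω) p ρ₀ a b s)
include hUc hagree

omit hUc in
/-- The image driver starts at `a + b/p`. [folklore] -/
theorem image_apply_zero : U ω' 0 = a + b / p := by
  rw [hagree 0 bot_le, imageDriver_zero hWc (pole_ne hW0 h.hq h.h0)
    (coe_rho_lt_swallowingTime hWc hW0 h hρ) h.hb, hW0, sub_zero]

omit hUc in
/-- The tracked point `a` is not the starting point of the image driver. [folklore] -/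
theorem far_ne_image_zero : a ≠ U ω' 0 := by
  rw [image_apply_zero hWc hW0 h hρ hagree]
  intro h'
  have : b / p = 0 := by linarith
  rcases div_eq_zero_iff.1 this with h1 | h1
  · exact h.hb.ne' h1
  · exact h.q_ne h1

/-- **The image gap at `clock u` is `-b d₁(u)/X_u`** (`u ≤ ρ₀`). [cite: Lawler2005, §6.3] -/
theorem gapProc_image_clockNN {u : ℝ≥0} (hu : u ≤ ρ₀) :
    gapProc U a (clockNN (W ω) p ρ₀ b u) ω' =
      -(b * poleDeriv (gap (W ω) p ρ₀) u / gap (W ω) p ρ₀ u) := by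
  have hp := pole_ne hW0 h.hq h.h0
  have hρT := coe_rho_lt_swallowingTime hWc hW0 h hρ
  have heq : ∀ s, s ≤ clockNN (W ω) p ρ₀ b u → imageDriver (W ω) p ρ₀ a b s = U ω' s :=
    fun s hs ↦ (hagree s (hs.trans (clockNN_mono hWc hp hρT h.hb hu))).symm
  rw [gapProc, realFlowStop_eq_of_eqOn (continuous_imageDriver hWc hp hρT h.hb) hUc heq le_rfl,
    realFlowStop_imageDriver_far hWc hp hρT h.hb hu]

/-- Before the horizon the image gap is in the second window. [folklore] -/
theorem gapProc_image_mem {u : ℝ≥0} (hu : u < ρ₀) :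
    gapProc U a (clockNN (W ω) p ρ₀ b u) ω' ∈ Ioo l₂ h₂ := by
  have hlt : (u : WithTop ℝ≥0) < locTime W p b l₁ h₁ l₂ h₂ ω := by
    rw [hρ]; exact WithTop.coe_lt_coe.2 hu
  rw [gapProc_image_clockNN hWc hW0 h hρ hUc hagree hu.le,
    ← imgGapProc_locTime_of_le hρ hu.le, imgGapProc_locTime_eq_of_le hlt.le]
  exact imgGapProc_mem_Ioo_of_lt hlt

omit hUc hagree in
/-- Every image time up to the total clock is the clock of an original time. [folklore] -/
theorem exists_eq_clockNN {t : ℝ≥0} (ht : t ≤ clockNN (W ω) p ρ₀ b ρ₀) :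
    ∃ u, u ≤ ρ₀ ∧ clockNN (W ω) p ρ₀ b u = t := by
  have hp := pole_ne hW0 h.hq h.h0
  have hρT := coe_rho_lt_swallowingTime hWc hW0 h hρ
  have hX := continuous_gap (u₁ := ρ₀) hWc hp
  have hX0 := gap_ne_zero hWc hp hρT
  have ht' : (t : ℝ) ∈ Icc 0 (clock b (gap (W ω) p ρ₀) ρ₀) := by
    refine ⟨t.coe_nonneg, ?_⟩
    rw [← coe_clockNN hWc hp hρT h.hb]
    exact NNReal.coe_le_coe.2 ht
  refine ⟨(invClock b (gap (W ω) p ρ₀) ρ₀ t).toNNReal, ?_, ?_⟩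
  · have := Real.toNNReal_le_toNNReal (invClock_mem_Icc hX hX0 h.hb.ne' ρ₀.coe_nonneg ht').2
    rwa [Real.toNNReal_coe] at this
  · rw [clockNN_invClock_toNNReal hWc hp hρT h.hb ht', Real.toNNReal_coe]

/-- **The image gap does not leave its window before the total clock.** [folklore] -/
theorem clockNN_le_gapExit_image :
    (clockNN (W ω) p ρ₀ b ρ₀ : WithTop ℝ≥0) ≤ gapExit U a l₂ h₂ ω' := by
  by_contra hlt
  push Not at hlt
  obtain ⟨t, ht⟩ := WithTop.ne_top_iff_exists.1 (ne_top_of_lt hlt)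
  rw [← ht, WithTop.coe_lt_coe] at hlt
  have hout := Process.notMem_Ioo_of_exitTime_eq_coe
    (continuous_gapProc hUc (far_ne_image_zero hWc hW0 h hρ hagree)) ht.symm
  obtain ⟨u, hu, hut⟩ := exists_eq_clockNN hWc hW0 h hρ hlt.le
  have hu' : u < ρ₀ := by
    refine lt_of_le_of_ne hu fun heq ↦ ?_
    rw [heq] at hut
    exact (hut ▸ hlt).false
  rw [← hut] at hout
  exact hout (gapProc_image_mem hWc hW0 h hρ hUc hagree hu')

/-- **The image jet at `clock u` is `d₁(u)`**: `exp(-∫₀^{clock u} 2/X̂²) = d₁(u)`.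
[cite: Lawler2005, §6.3] -/
theorem jetProc_image_clockNN {u : ℝ≥0} (hu : u ≤ ρ₀) :
    jetProc U a (gapExit U a l₂ h₂) (clockNN (W ω) p ρ₀ b u) ω' = poleDeriv (gap (W ω) p ρ₀) u := by
  have hp := pole_ne hW0 h.hq h.h0
  have hρT := coe_rho_lt_swallowingTime hWc hW0 h hρ
  have hX := continuous_gap (u₁ := ρ₀) hWc hp
  have hX0 := gap_ne_zero hWc hp hρT
  have hσ := clockNN_le_gapExit_image hWc hW0 h hρ hUc hagree
  have hle : (clockNN (W ω) p ρ₀ b u : WithTop ℝ≥0) ≤ gapExit U a l₂ h₂ ω' :=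
    (WithTop.coe_le_coe.2 (clockNN_mono hWc hp hρT h.hb hu)).trans hσ
  rw [jetProc_eq, stopT_of_le hle, poleDeriv, coe_clockNN hWc hp hρT h.hb,
    ← exp_neg_integral_imageGap hX hX0 h.hb.ne' ρ₀.coe_nonneg ⟨u.coe_nonneg, NNReal.coe_le_coe.2 hu⟩]
  congr 2
  refine intervalIntegral.integral_congr fun r hr ↦ ?_
  rw [uIcc_of_le (clock_nonneg hX hX0 h.hb.ne' u.coe_nonneg)] at hr
  have hr' : r ∈ Icc 0 (clock b (gap (W ω) p ρ₀) ρ₀) :=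
    ⟨hr.1, hr.2.trans ((strictMono_clock hX hX0 h.hb.ne').monotone (NNReal.coe_le_coe.2 hu))⟩
  have hυ := invClock_mem_Icc hX hX0 h.hb.ne' ρ₀.coe_nonneg hr'
  have hυle : (invClock b (gap (W ω) p ρ₀) ρ₀ r).toNNReal ≤ ρ₀ := by
    have := Real.toNNReal_le_toNNReal hυ.2
    rwa [Real.toNNReal_coe] at this
  have hrle : ((r.toNNReal : ℝ≥0) : WithTop ℝ≥0) ≤ gapExit U a l₂ h₂ ω' := by
    rw [← clockNN_invClock_toNNReal hWc hp hρT h.hb hr']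
    exact (WithTop.coe_le_coe.2 (clockNN_mono hWc hp hρT h.hb hυle)).trans hσ
  show 2 / gapPath U a (gapExit U a l₂ h₂) ω' r ^ 2 = _
  rw [gapPath_of_le hrle, ← clockNN_invClock_toNNReal hWc hp hρT h.hb hr',
    gapProc_image_clockNN hWc hW0 h hρ hUc hagree hυle, Real.coe_toNNReal _ hυ.1]

/-- **The image's image gap is the original gap**: `-b d̂₁/X̂ = X ∘ υ` at `clock u`.
[cite: Lawler2005, §6.3] -/
theorem imgGapProc_image_clockNN {u : ℝ≥0} (hu : u ≤ ρ₀) :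
    imgGapProc U a (gapExit U a l₂ h₂) b (clockNN (W ω) p ρ₀ b u) ω' = gap (W ω) p ρ₀ u := by
  have hp := pole_ne hW0 h.hq h.h0
  have hρT := coe_rho_lt_swallowingTime hWc hW0 h hρ
  have hX0 := gap_ne_zero hWc hp hρT (u₁ := ρ₀)
  have hσ := clockNN_le_gapExit_image hWc hW0 h hρ hUc hagree
  have hle : (clockNN (W ω) p ρ₀ b u : WithTop ℝ≥0) ≤ gapExit U a l₂ h₂ ω' :=
    (WithTop.coe_le_coe.2 (clockNN_mono hWc hp hρT h.hb hu)).trans hσ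
  rw [imgGapProc, jetProc_image_clockNN hWc hW0 h hρ hUc hagree hu, gapStop_of_le hle,
    gapProc_image_clockNN hWc hW0 h hρ hUc hagree hu]
  have hd := (poleDeriv_pos (X := gap (W ω) p ρ₀) u).ne'
  have hb := h.hb.ne'
  have hx := hX0 u
  field_simp

/-- Before the horizon the image's image gap is in the first window. [folklore] -/
theorem imgGapProc_image_mem {u : ℝ≥0} (hu : u < ρ₀) :
    imgGapProc U a (gapExit U a l₂ h₂) b (clockNN (W ω) p ρ₀ b u) ω' ∈ Ioo l₁ h₁ := by
  have hlt : (u : WithTop ℝ≥0) < locTime W p b l₁ h₁ l₂ h₂ ω := by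
    rw [hρ]; exact WithTop.coe_lt_coe.2 hu
  rw [imgGapProc_image_clockNN hWc hW0 h hρ hUc hagree hu.le, gap_coe hu.le]
  exact gapProc_mem_Ioo_of_lt hlt

variable (hap : a + b / p = 0) (ha : a ∈ Ioo l₂ h₂)
include hap ha

omit hUc ha in
/-- The image driver starts at `0`. [folklore] -/
theorem image_zero : U ω' 0 = 0 := by
  rw [image_apply_zero hWc hW0 h hρ hagree, hap]

/-- The image's image-gap process has continuous paths. [folklore] -/
theorem continuous_imgGapProc_image :
    Continuous fun s ↦ imgGapProc U a (gapExit U a l₂ h₂) b s ω' :=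
  continuous_imgGapProc (gapStop_gapExit_mem_Icc hUc (image_zero hWc hW0 h hρ hagree hap) ha h.h0')
    h.h0' hUc (far_ne_image_zero hWc hW0 h hρ hagree)

/-- **The image's image gap does not leave its window before the total clock.** [folklore] -/
theorem clockNN_le_imgExit_image :
    (clockNN (W ω) p ρ₀ b ρ₀ : WithTop ℝ≥0) ≤ imgExit U a b l₂ h₂ l₁ h₁ ω' := by
  by_contra hlt
  push Not at hlt
  obtain ⟨t, ht⟩ := WithTop.ne_top_iff_exists.1 (ne_top_of_lt hlt)
  rw [← ht, WithTop.coe_lt_coe] at hlt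
  have hout := Process.notMem_Ioo_of_exitTime_eq_coe
    (continuous_imgGapProc_image hWc hW0 h hρ hUc hagree hap ha) ht.symm
  obtain ⟨u, hu, hut⟩ := exists_eq_clockNN hWc hW0 h hρ hlt.le
  have hu' : u < ρ₀ := by
    refine lt_of_le_of_ne hu fun heq ↦ ?_
    rw [heq] at hut
    exact (hut ▸ hlt).false
  rw [← hut] at hout
  exact hout (imgGapProc_image_mem hWc hW0 h hρ hUc hagree hu')

/-- **The image localisation time is at most the total clock**: at `ρ₀` one of the original
processes has left its window, hence so has the corresponding image process at `clock ρ₀`.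
[folklore] -/
theorem locTime_image_le :
    locTime U a b l₂ h₂ l₁ h₁ ω' ≤ (clockNN (W ω) p ρ₀ b ρ₀ : WithTop ℝ≥0) := by
  have hp := pole_ne hW0 h.hq h.h0
  have hmin : gapExit W p l₁ h₁ ω = ρ₀ ∨ imgExit W p b l₁ h₁ l₂ h₂ ω = ρ₀ := by
    have := hρ
    rw [locTime, min_eq_iff] at this
    rcases this with h1 | h1
    · exact Or.inl h1.1
    · exact Or.inr h1.1
  rcases hmin with h1 | h1
  · -- the original gap is out of `(l₁, h₁)` at `ρ₀`; so is `-b d̂₁/X̂` at `clock ρ₀`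
    have hout := Process.notMem_Ioo_of_exitTime_eq_coe (continuous_gapProc hWc hp) h1
    refine (min_le_right _ _).trans ((Process.exitTime_le_coe_iff
      (continuous_imgGapProc_image hWc hW0 h hρ hUc hagree hap ha)).2 ⟨_, le_rfl, ?_⟩)
    rwa [imgGapProc_image_clockNN hWc hW0 h hρ hUc hagree le_rfl, gap_coe le_rfl]
  · -- the original image gap is out of `(l₂, h₂)` at `ρ₀`; so is `X̂` at `clock ρ₀`
    have hc : Continuous fun s ↦ imgGapProc W p (gapExit W p l₁ h₁) b s ω :=
      continuous_imgGapProc (gapStop_gapExit_mem_Icc hWc hW0 h.hq h.h0) h.h0 hWc hp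
    have hout := Process.notMem_Ioo_of_exitTime_eq_coe hc h1
    refine (min_le_left _ _).trans ((Process.exitTime_le_coe_iff
      (continuous_gapProc hUc (far_ne_image_zero hWc hW0 h hρ hagree))).2 ⟨_, le_rfl, ?_⟩)
    rwa [gapProc_image_clockNN hWc hW0 h hρ hUc hagree le_rfl,
      ← imgGapProc_locTime_of_le hρ le_rfl, imgGapProc_locTime_eq_of_le hρ.symm.le]

/-- **The localisation time is an intrinsic functional of the image driver**: the localisation
functional with pole `a`, the same `b` and the two windows swapped, evaluated on any driver that
agrees with the image driver up to the total clock, returns the total clock `clock ρ₀`.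
[cite: Lawler2005, §6.3 Thm. 6.13 (proof)] -/
theorem locTime_image_eq :
    locTime U a b l₂ h₂ l₁ h₁ ω' = (clockNN (W ω) p ρ₀ b ρ₀ : WithTop ℝ≥0) :=
  le_antisymm (locTime_image_le hWc hW0 h hρ hUc hagree hap ha)
    (le_min (clockNN_le_gapExit_image hWc hW0 h hρ hUc hagree)
      (clockNN_le_imgExit_image hWc hW0 h hρ hUc hagree hap ha))

end LocIdentity

/-! ### The limit of the localisation times -/

section Limit

variable {Ω : Type*} {W : Ω → ℝ≥0 → ℝ} {ω : Ω} {p b : ℝ}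

/-- `poleDeriv` at `u ≥ 0` depends only on the path on `[0, u]`. [folklore] -/
theorem poleDeriv_congr {X X' : ℝ → ℝ} {u : ℝ} (hu : 0 ≤ u) (h : EqOn X X' (Icc 0 u)) :
    poleDeriv X u = poleDeriv X' u := by
  rw [poleDeriv, poleDeriv]
  congr 2
  refine intervalIntegral.integral_congr fun r hr ↦ ?_
  rw [uIcc_of_le hu] at hr
  simp only [h hr]

variable (hWc : Continuous (W ω)) (hW0 : W ω 0 = 0) (hp : p ≠ 0)
include hWc hW0 hp

omit hWc in
/-- The pole is not the starting point. [folklore] -/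
theorem pole_ne_zero' : p ≠ W ω 0 := by rwa [hW0]

/-- **The clamped gap keeps the sign of the pole** (`u₁ < T_p`): `0 < p X_u`. [folklore] -/
theorem pos_mul_gap {u₁ : ℝ≥0} (hu₁ : (u₁ : WithTop ℝ≥0) < swallowingTime (W ω) p) (u : ℝ) :
    0 < p * gap (W ω) p u₁ u := by
  have hp' := pole_ne_zero' hW0 hp
  have hX := continuous_gap (u₁ := u₁) hWc hp'
  have hX0 := gap_ne_zero hWc hp' hu₁
  have h0 : p * gap (W ω) p u₁ 0 = p * p := by
    have : gap (W ω) p u₁ ((0 : ℝ≥0) : ℝ) = p := by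
      rw [gap_coe (show (0 : ℝ≥0) ≤ u₁ from zero_le), realFlowStop_zero_of_ne hWc hp', hW0, sub_zero]
    rw [NNReal.coe_zero] at this
    rw [this]
  by_contra hle
  push Not at hle
  have hφ : Continuous fun r ↦ p * gap (W ω) p u₁ r := continuous_const.mul hX
  have hmem : (0 : ℝ) ∈ uIcc (p * gap (W ω) p u₁ u) (p * gap (W ω) p u₁ 0) := by
    rw [h0]
    exact mem_uIcc.2 (Or.inl ⟨hle, (mul_self_pos.2 hp).le⟩)
  obtain ⟨r, -, hr⟩ := intermediate_value_uIcc hφ.continuousOn hmem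
  rcases mul_eq_zero.1 hr with h1 | h1
  · exact hp h1
  · exact hX0 r h1

variable (hb : 0 < b)
include hb

/-- **The localisation times are bounded by the swallowing time.** [folklore] -/
theorem locTime_win_lt (hT : swallowingTime (W ω) p < ⊤) (n : ℕ) :
    ∃ r : ℝ≥0, locTime W p b (winLo p n) (winHi p n) (winLo (-(b / p)) n) (winHi (-(b / p)) n) ω = r ∧
      (r : WithTop ℝ≥0) < swallowingTime (W ω) p := by
  have hg := locGood_win hp hb n
  set ρ := locTime W p b (winLo p n) (winHi p n) (winLo (-(b / p)) n) (winHi (-(b / p)) n) ω with hρ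
  obtain ⟨T₀, hT₀⟩ := WithTop.ne_top_iff_exists.1 hT.ne
  rcases eq_or_ne ρ ⊤ with htop | hne
  · have := coe_lt_swallowingTime_of_le_locTime hWc hW0 hg.hq hg.h0 (s := T₀) (b := b)
      (l₂ := winLo (-(b / p)) n) (h₂ := winHi (-(b / p)) n) (by rw [← hρ, htop]; exact le_top)
    rw [← hT₀] at this
    exact absurd this (lt_irrefl _)
  · obtain ⟨r, hr⟩ := WithTop.ne_top_iff_exists.1 hne
    exact ⟨r, hr.symm, coe_lt_swallowingTime_of_le_locTime hWc hW0 hg.hq hg.h0 (by rw [← hρ, hr])⟩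

/-- **The localisation times exhaust `[0, T_p)`**: for `t < T_p`, eventually `t < ρ_n` (the gap
and the image gap are continuous and nonvanishing on `[0, t]`, so they fit in the `n`-th windows
for `n` large). [folklore] -/
theorem eventually_lt_locTime_win {t : ℝ≥0} (ht : (t : WithTop ℝ≥0) < swallowingTime (W ω) p) :
    ∀ᶠ n : ℕ in atTop,
      (t : WithTop ℝ≥0) < locTime W p b (winLo p n) (winHi p n) (winLo (-(b / p)) n) (winHi (-(b / p)) n) ω := by
  have hp' := pole_ne_zero' hW0 hp
  set X : ℝ → ℝ := gap (W ω) p t with hXdef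
  have hX : Continuous X := continuous_gap hWc hp'
  have hX0 : ∀ u, X u ≠ 0 := gap_ne_zero hWc hp' ht
  have hsgn : ∀ u, 0 < p * X u := pos_mul_gap hWc hW0 hp ht
  set Ξ : ℝ → ℝ := fun u ↦ -(b * poleDeriv X u / X u) with hΞdef
  have hΞ : Continuous Ξ := ((continuous_const.mul (continuous_poleDeriv hX hX0)).div hX hX0).neg
  have hΞsgn : ∀ u, 0 < -(b / p) * Ξ u := fun u ↦ by
    have h1 := hsgn u
    have h2 := poleDeriv_pos (X := X) u
    have hpX : 0 < p * X u := h1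
    rw [hΞdef]
    simp only
    rw [show -(b / p) * -(b * poleDeriv X u / X u) = b * b * poleDeriv X u / (p * X u) by
      field_simp]
    positivity
  have hΞ0 : ∀ u, Ξ u ≠ 0 := fun u h0 ↦ by simpa [h0] using hΞsgn u
  -- extrema of `|X|`, `|Ξ|` on `[0, t]`
  have hK : IsCompact (Icc (0 : ℝ) t) := isCompact_Icc
  have hKne : (Icc (0 : ℝ) t).Nonempty := nonempty_Icc.2 t.coe_nonneg
  obtain ⟨u₁, hu₁, hmin₁⟩ := hK.exists_isMinOn hKne (continuous_abs.comp hX).continuousOn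
  obtain ⟨v₁, hv₁, hmax₁⟩ := hK.exists_isMaxOn hKne (continuous_abs.comp hX).continuousOn
  obtain ⟨u₂, hu₂, hmin₂⟩ := hK.exists_isMinOn hKne (continuous_abs.comp hΞ).continuousOn
  obtain ⟨v₂, hv₂, hmax₂⟩ := hK.exists_isMaxOn hKne (continuous_abs.comp hΞ).continuousOn
  have hm₁ : 0 < |X u₁| := abs_pos.2 (hX0 u₁)
  have hm₂ : 0 < |Ξ u₂| := abs_pos.2 (hΞ0 u₂)
  filter_upwards [eventually_winBound_lt p hm₁, eventually_lt_winBound p (|X v₁|),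
    eventually_winBound_lt (-(b / p)) hm₂, eventually_lt_winBound (-(b / p)) (|Ξ v₂|)] with n h1 h2 h3 h4
  have hg := locGood_win hp hb n
  -- values on `[0, t]` are in the windows
  have hXwin : ∀ r ∈ Icc (0 : ℝ) t, X r ∈ Ioo (winLo p n) (winHi p n) := fun r hr ↦
    mem_win (hsgn r) (h1.trans_le (hmin₁ hr)) ((hmax₁ hr).trans_lt h2)
  have hΞwin : ∀ r ∈ Icc (0 : ℝ) t, Ξ r ∈ Ioo (winLo (-(b / p)) n) (winHi (-(b / p)) n) := fun r hr ↦
    mem_win (hΞsgn r) (h3.trans_le (hmin₂ hr)) ((hmax₂ hr).trans_lt h4)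
  -- the gap stays in its window up to `t`
  have hgap : ∀ s : ℝ≥0, s ≤ t → gapProc W p s ω = X s := fun s hs ↦ (gap_coe hs).symm
  have hexit₁ : (t : WithTop ℝ≥0) < gapExit W p (winLo p n) (winHi p n) ω := by
    by_contra hle
    push Not at hle
    obtain ⟨j, hj, hout⟩ := (Process.exitTime_le_coe_iff (continuous_gapProc hWc hp')).1 hle
    rw [hgap j hj] at hout
    exact hout (hXwin j ⟨j.coe_nonneg, NNReal.coe_le_coe.2 hj⟩)
  -- the image gap (frozen at the gap exit) is `Ξ` up to `t`
  have himg : ∀ s : ℝ≥0, s ≤ t →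
      imgGapProc W p (gapExit W p (winLo p n) (winHi p n)) b s ω = Ξ s := by
    intro s hs
    have hsτ : (s : WithTop ℝ≥0) ≤ gapExit W p (winLo p n) (winHi p n) ω :=
      (WithTop.coe_le_coe.2 hs).trans hexit₁.le
    rw [imgGapProc_eq, stopT_of_le hsτ]
    have hpath : EqOn (gapPath W p (gapExit W p (winLo p n) (winHi p n)) ω) X (Icc 0 s) := by
      intro r hr
      have hr' : (r.toNNReal : ℝ≥0) ≤ t := (Real.toNNReal_le_iff_le_coe.2 hr.2).trans hs
      rw [gapPath_of_le ((WithTop.coe_le_coe.2 hr').trans hexit₁.le), hgap _ hr',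
        Real.coe_toNNReal _ hr.1]
    rw [hΞdef]
    simp only
    rw [poleDeriv_congr s.coe_nonneg hpath, hpath ⟨s.coe_nonneg, le_rfl⟩]
  have hexit₂ : (t : WithTop ℝ≥0) <
      imgExit W p b (winLo p n) (winHi p n) (winLo (-(b / p)) n) (winHi (-(b / p)) n) ω := by
    by_contra hle
    push Not at hle
    have hc : Continuous fun s ↦ imgGapProc W p (gapExit W p (winLo p n) (winHi p n)) b s ω :=
      continuous_imgGapProc (gapStop_gapExit_mem_Icc hWc hW0 hg.hq hg.h0) hg.h0 hWc hp'
    obtain ⟨j, hj, hout⟩ := (Process.exitTime_le_coe_iff hc).1 hle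
    rw [himg j hj] at hout
    exact hout (hΞwin j ⟨j.coe_nonneg, NNReal.coe_le_coe.2 hj⟩)
  exact lt_min hexit₁ hexit₂

/-- **The localisation times converge to the swallowing time of the pole** (finite swallowing
time; stated for the finite parts). [folklore] -/
theorem tendsto_untopD_locTime_win (hT : swallowingTime (W ω) p < ⊤) :
    Tendsto (fun n : ℕ ↦ (locTime W p b (winLo p n) (winHi p n) (winLo (-(b / p)) n)
      (winHi (-(b / p)) n) ω).untopD 0) atTop (𝓝 ((swallowingTime (W ω) p).untopD 0)) := by
  obtain ⟨T₀, hT₀⟩ := WithTop.ne_top_iff_exists.1 hT.ne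
  rw [← hT₀, WithTop.untopD_coe]
  refine tendsto_order.2 ⟨fun t ht ↦ ?_, fun t ht ↦ Eventually.of_forall fun n ↦ ?_⟩
  · have ht' : (t : WithTop ℝ≥0) < swallowingTime (W ω) p := by
      rw [← hT₀]; exact WithTop.coe_lt_coe.2 ht
    filter_upwards [eventually_lt_locTime_win hWc hW0 hp hb ht'] with n hn
    obtain ⟨r, hr, -⟩ := locTime_win_lt hWc hW0 hp hb hT n
    rw [hr, WithTop.untopD_coe]
    rw [hr] at hn
    exact WithTop.coe_lt_coe.1 hn
  · obtain ⟨r, hr, hrT⟩ := locTime_win_lt hWc hW0 hp hb hT n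
    rw [hr, WithTop.untopD_coe]
    rw [← hT₀] at hrT
    exact (WithTop.coe_lt_coe.1 hrT).trans ht

end Limit

end MoebiusPole

end Literature.Probability.RandomPlanarGeometry

/-!
## Part C. The probabilistic assembly
-/

noncomputable section

open MeasureTheory ProbabilityTheory Filter Set Function Complex
open scoped NNReal ENNReal Topology

namespace Literature.Probability.RandomPlanarGeometry

namespace MoebiusPole

open Loewner Literature.Probability.Process Literature.Analysis.FunctionSpaces
open scoped PathBorel

/-! ### The localisation functional and the stopped class on path space -/

section PathSpace

/-- **The localisation time is a Borel functional on path space** (driving family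
`η ↦ η - η 0` on `C(ℝ≥0, ℝ)`, constant Borel filtration; finite part). [folklore] -/
theorem measurable_untopD_locTime_path {q b l₁ h₁ l₂ h₂ : ℝ} (h0 : 0 < l₁ ∨ h₁ < 0)
    (hq : q ∈ Ioo l₁ h₁) :
    Measurable fun η : C(ℝ≥0, ℝ) ↦
      (locTime (fun (η : C(ℝ≥0, ℝ)) (s : ℝ≥0) ↦ η s - η 0) q b l₁ h₁ l₂ h₂ η).untopD 0 := by
  have hWc : ∀ η : C(ℝ≥0, ℝ), Continuous fun s : ℝ≥0 ↦ η s - η 0 := fun η ↦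
    η.continuous.sub continuous_const
  have hW0 : ∀ η : C(ℝ≥0, ℝ), (fun s : ℝ≥0 ↦ η s - η 0) 0 = 0 := fun η ↦ sub_self _
  have hWad : Adapted (Filtration.const ℝ≥0 (inferInstance : MeasurableSpace C(ℝ≥0, ℝ)) le_rfl)
      fun s (η : C(ℝ≥0, ℝ)) ↦ η s - η 0 := by
    intro s
    show Measurable fun η : C(ℝ≥0, ℝ) ↦ η s - η 0
    exact ((continuous_eval_const s).sub (continuous_eval_const (0 : ℝ≥0))).measurable
  exact ((isStoppingTime_locTime (W := fun (η : C(ℝ≥0, ℝ)) (s : ℝ≥0) ↦ η s - η 0) (b := b)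
    (l₂ := l₂) (h₂ := h₂) hWc hW0 hWad h0 hq).measurable').untopD 0

/-- **The stopped class is a Borel functional on path space**: the class of the trace of `η`
(`traceOf`) stopped at the localisation time of `η`. [folklore] -/
theorem measurable_stopClass_traceOf_locTime {q b l₁ h₁ l₂ h₂ : ℝ} (h0 : 0 < l₁ ∨ h₁ < 0)
    (hq : q ∈ Ioo l₁ h₁) :
    Measurable fun η : C(ℝ≥0, ℝ) ↦ stopClass (traceOf η)
      ((locTime (fun (η : C(ℝ≥0, ℝ)) (s : ℝ≥0) ↦ η s - η 0) q b l₁ h₁ l₂ h₂ η).untopD 0) :=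
  Measurable.stopClass measurable_traceOf (measurable_untopD_locTime_path h0 hq)

end PathSpace

/-! ### The image Brownian motion on the product space -/

section ImageBM

variable {p a b l₁ h₁ l₂ h₂ : ℝ}

/-- **The image Brownian motion.** For window data `h` and `a + b/p = 0` there is, on the product of
two Wiener spaces, a real Brownian motion `B̃` with continuous paths and measurable marginals such
that `√6 B̃` agrees with the image driving function in capacity time of the sample `ω`
(`imageDriver (√6 B(ω)) p ρ a b`, `ρ = ρ(ω)` the localisation time) up to the total clock of `ρ`:
the DDS time change of the stopped image driver by its martingale clock
(`hasMartingaleClock_normDrv_six`, `HasMartingaleClock.timeChange`), concatenated with an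
independent Brownian motion (`isBrownianReal_concat`) and Brownian-scaled (`IsBrownianReal.smul`).
Lawler: "`Ũ_t := U*_{r(t)}` … has the same distribution as [`√6 ×`] a standard Brownian motion".
[cite: Lawler2005, §6.3 Thm. 6.13 (proof)] -/
theorem exists_imageBM (h : LocGood p b l₁ h₁ l₂ h₂) (hap : a + b / p = 0) :
    ∃ Bc : ℝ≥0 → (ℝ≥0 → ℝ) × (ℝ≥0 → ℝ) → ℝ,
      IsBrownianReal Bc ((preWienerMeasure).prod preWienerMeasure) ∧ (∀ t, Measurable (Bc t)) ∧
      (∀ z, Continuous (Bc · z)) ∧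
      ∀ (z : (ℝ≥0 → ℝ) × (ℝ≥0 → ℝ)) (ρ₀ : ℝ≥0), rho 6 p b l₁ h₁ l₂ h₂ z.1 = ρ₀ →
        ∀ s : ℝ≥0, s ≤ clockNN (sleW 6 z.1) p ρ₀ b ρ₀ →
          Real.sqrt 6 * Bc s z = imageDriver (sleW 6 z.1) p ρ₀ a b s := by
  haveI := isProbabilityMeasure_preWienerMeasure'
  have h6 : (6 : ℝ≥0) ≠ 0 := by norm_num
  set P : Measure (ℝ≥0 → ℝ) := preWienerMeasure with hPdef
  set τ := rho 6 p b l₁ h₁ l₂ h₂ with hτdef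
  set Tn : ℝ≥0 := (locBound b l₁ h₁ l₂ h₂).toNNReal with hTn
  set ρ : (ℝ≥0 → ℝ) → ℝ≥0 := fun ω ↦ (min (Tn : WithTop ℝ≥0) (τ ω)).untopA with hρdef
  have hρcoe : ∀ ω, (ρ ω : WithTop ℝ≥0) = τ ω := fun ω ↦ by
    show (((min (Tn : WithTop ℝ≥0) (τ ω)).untopA : ℝ≥0) : WithTop ℝ≥0) = τ ω
    rw [coe_untopA_min, min_eq_right (rho_le h ω)]
  set Y := normDrv 6 p a b l₁ h₁ l₂ h₂ with hYdef
  set c := normClock 6 p b l₁ h₁ l₂ h₂ with hcdef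
  set 𝓕 : Filtration ℝ≥0 (inferInstance : MeasurableSpace (ℝ≥0 → ℝ)) := brownianFiltration with h𝓕
  set L : ℝ := normL 6 b l₁ h₁ with hLdef
  have hL : 0 < L := normL_pos h h6
  -- Step 1: the martingale clock and the time change
  have hclock : HasMartingaleClock Y c 𝓕 P (normBound 6 b l₁ h₁ l₂ h₂) :=
    hasMartingaleClock_normDrv_six h
  have hYad : StronglyAdapted 𝓕 Y := stronglyAdapted_normDrv h
  have hYc : ∀ ω, Continuous (Y · ω) := continuous_normDrv h
  have hcad : Adapted 𝓕 c := adapted_normClock h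
  have hρst : IsStoppingTime 𝓕 fun ω ↦ (ρ ω : WithTop ℝ≥0) := by
    have heq : (fun ω ↦ (ρ ω : WithTop ℝ≥0)) = τ := funext hρcoe
    rw [heq]; exact isStoppingTime_rho h
  have hρT : ∀ ω, ρ ω ≤ Tn := fun ω ↦ untopA_min_le _ _
  have hstopT : ∀ (t : ℝ≥0) ω, stopT τ (min t (ρ ω)) ω = stopT τ t ω := by
    intro t ω
    have : min t (ρ ω) = (min (t : WithTop ℝ≥0) (τ ω)).untopA := by
      rw [← hρcoe, untopA_min_coe_coe]
    rw [this, stopT_min]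
  have hfrozen : ∀ t ω, c t ω = c (min t (ρ ω)) ω := fun t ω ↦
    (normClock_congr_stopT (hstopT t ω)).symm
  have htc := hclock.timeChange hYad hYc hcad hρst hρT hfrozen
  have hcc := hclock.continuous_clock
  have hc0 := hclock.clock_zero
  have hmono := hclock.monotone_clock
  have hnn : ∀ t ω, 0 ≤ c t ω := fun t ω ↦ hclock.clock_nonneg ω t
  have hstrict : ∀ ω, StrictMonoOn (fun t ↦ c t ω) (Icc 0 (ρ ω)) := fun ω ↦
    (strictMonoOn_normClock h h6 ω).mono fun s hs ↦ by
      show (s : WithTop ℝ≥0) ≤ τ ω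
      rw [← hρcoe]; exact WithTop.coe_le_coe.2 hs.2
  set 𝒢 := tcFiltration hcad hcc hρst with h𝒢def
  -- Step 2: concatenation with an independent Brownian motion
  set σc : (ℝ≥0 → ℝ) → ℝ≥0 := fun ω ↦ (totalClock c ρ ω).toNNReal with hσcdef
  have hσc0 : ∀ ω, 0 ≤ totalClock c ρ ω := fun ω ↦ hclock.clock_nonneg ω _
  have hσccoe : ∀ ω, ((σc ω : ℝ≥0) : ℝ) = totalClock c ρ ω := fun ω ↦ Real.coe_toNNReal _ (hσc0 ω)
  have hmin_eq : ∀ (s : ℝ≥0) ω, min (s : ℝ) (totalClock c ρ ω) = ((min s (σc ω) : ℝ≥0) : ℝ) := by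
    intro s ω; rw [NNReal.coe_min, hσccoe]
  have htc' : HasMartingaleClock (tcProc Y c ρ) (fun s ω ↦ ((min s (σc ω) : ℝ≥0) : ℝ)) 𝒢 P
      (normBound 6 b l₁ h₁ l₂ h₂) := by
    have heq : (fun (s : ℝ≥0) ω ↦ ((min s (σc ω) : ℝ≥0) : ℝ)) =
        fun (s : ℝ≥0) ω ↦ min (s : ℝ) (totalClock c ρ ω) := by
      funext s ω; exact (hmin_eq s ω).symm
    rw [heq]; exact htc
  have hYprog : IsStronglyProgressive 𝓕 Y := hYad.isStronglyProgressive_of_continuous hYc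
  have hcontY : ∀ ω, Continuous fun s ↦ tcProc Y c ρ s ω := continuous_tcProc hYc hc0 hcc hmono hstrict
  have hYad' : ∀ s, StronglyMeasurable[𝒢 s] (tcProc Y c ρ s) := fun s ↦
    (measurable_tcProc hcad hcc hρst hYprog s).stronglyMeasurable
  have hσcm : Measurable σc := (measurable_totalClock hcad hcc hρst).real_toNNReal
  have hcad' : ∀ s : ℝ≥0, Measurable[𝒢 s] fun ω ↦ min s (σc ω) := by
    intro s
    have h1 := (measurable_min_totalClock hcad hcc hρst hc0 hmono hfrozen s).real_toNNReal
    have heq : (fun ω ↦ (min (s : ℝ) (totalClock c ρ ω)).toNNReal) = fun ω ↦ min s (σc ω) := by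
      funext ω; rw [hmin_eq, Real.toNNReal_coe]
    rwa [heq] at h1
  have hY0 : ∀ ω, tcProc Y c ρ 0 ω = 0 := fun ω ↦ by
    rw [tcProc_zero hc0]; exact normDrv_zero ω
  set M : ℝ≥0 → (ℝ≥0 → ℝ) × (ℝ≥0 → ℝ) → ℝ := fun s z ↦ tcProc Y c ρ s z.1 +
    (Process.brownian s z.2 - Process.brownian (min s (σc z.1)) z.2) with hMdef
  have hBM : IsBrownianReal M (P.prod preWienerMeasure) :=
    isBrownianReal_concat htc' hcontY hYad' hσcm hcad' hY0 rfl
  have hMc : ∀ z, Continuous (M · z) := continuous_concat rfl hcontY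
  have hMm : ∀ t, Measurable (M t) := measurable_concat hMdef hYad' hcad'
  -- Step 3: Brownian scaling `B̃_t = √K M_{t/K}`, `K = L²/6`
  set K : ℝ := L ^ 2 / 6 with hKdef
  have hK : 0 < K := by positivity
  set cK : ℝ≥0 := (K.toNNReal)⁻¹ with hcKdef
  have hKnn : (K.toNNReal : ℝ) = K := Real.coe_toNNReal _ hK.le
  have hcK0 : cK ≠ 0 := inv_ne_zero (by rw [← NNReal.coe_ne_zero, hKnn]; exact hK.ne')
  have hcKcoe : (cK : ℝ) = 6 / L ^ 2 := by
    rw [hcKdef, NNReal.coe_inv, hKnn, hKdef, inv_div]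
  set Bc : ℝ≥0 → (ℝ≥0 → ℝ) × (ℝ≥0 → ℝ) → ℝ := fun t z ↦ (√(cK : ℝ))⁻¹ * M (cK * t) z with hBcdef
  have hBcBM : IsBrownianReal Bc (P.prod preWienerMeasure) := hBM.smul hcK0
  have hBcc : ∀ z, Continuous (Bc · z) := fun z ↦
    continuous_const.mul ((hMc z).comp (continuous_const.mul continuous_id))
  have hBcm : ∀ t, Measurable (Bc t) := fun t ↦ (hMm _).const_mul _
  have hsqrt : Real.sqrt 6 * (√(cK : ℝ))⁻¹ = L := by
    rw [hcKdef, NNReal.coe_inv, hKnn, Real.sqrt_inv, inv_inv, ← Real.sqrt_mul (by norm_num), hKdef,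
      mul_div_cancel₀ _ (by norm_num : (6 : ℝ) ≠ 0), Real.sqrt_sq hL.le]
  have hU : ∀ (s : ℝ≥0) z, Real.sqrt 6 * Bc s z = L * M (cK * s) z := by
    intro s z; rw [hBcdef]; simp only; rw [← mul_assoc, hsqrt]
  refine ⟨Bc, hBcBM, hBcm, hBcc, ?_⟩
  -- Step 4: agreement with the image driver in capacity time
  rintro ⟨ω, ω'⟩ ρ₀ hρ₀ s hs
  simp only at hρ₀ ⊢
  have hWc : Continuous (sleW 6 ω) := continuous_sleW ω
  have hW0 : sleW 6 ω 0 = 0 := sleW_zero ω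
  have hp' : p ≠ sleW 6 ω 0 := by rw [hW0]; exact h.q_ne
  have hρT' : (ρ₀ : WithTop ℝ≥0) < swallowingTime (sleW 6 ω) p :=
    coe_rho_lt_swallowingTime hWc hW0 h hρ₀
  have hρω : ρ ω = ρ₀ := WithTop.coe_injective ((hρcoe ω).trans hρ₀)
  set X : ℝ → ℝ := gap (sleW 6 ω) p ρ₀ with hXdef
  have hX : Continuous X := continuous_gap hWc hp'
  have hX0 : ∀ u, X u ≠ 0 := gap_ne_zero hWc hp' hρT'
  have hb0 := h.hb.ne'
  have hs' : (s : ℝ) ∈ Icc 0 (clock b X ρ₀) := by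
    refine ⟨s.coe_nonneg, ?_⟩
    rw [← coe_clockNN hWc hp' hρT' h.hb]
    exact NNReal.coe_le_coe.2 hs
  set u : ℝ := invClock b X ρ₀ s with hudef
  have humem : u ∈ Icc (0 : ℝ) ρ₀ := invClock_mem_Icc hX hX0 hb0 ρ₀.coe_nonneg hs'
  have hcu : clock b X u = s :=
    clock_invClock_of_mem hX hX0 hb0 ρ₀.coe_nonneg (Ioo_subset_Icc_self (Icc_subset_Ioo_clock hX hX0 hb0 hs'))
  set u' : ℝ≥0 := u.toNNReal with hu'def
  have hu'coe : (u' : ℝ) = u := Real.coe_toNNReal _ humem.1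
  have hu'le : u' ≤ ρ₀ := by
    have := Real.toNNReal_le_toNNReal humem.2; rwa [Real.toNNReal_coe] at this
  have hu'ρ : u' ≤ ρ ω := hρω ▸ hu'le
  have hu'τ : (u' : WithTop ℝ≥0) ≤ τ ω := by rw [← hρcoe]; exact WithTop.coe_le_coe.2 hu'ρ
  -- the stopped processes at `u'`
  have hpath : gapPath (sleW 6) p τ ω = X := gapPath_eq_gap hρ₀
  have hWt : Wt 6 p a b l₁ h₁ l₂ h₂ u' ω = driver a b X u := by
    show drvProc (sleW 6) p τ a b u' ω = _
    rw [drvProc_eq, hpath, stopT_of_le hu'τ, hu'coe]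
  have hWt0 : Wt 6 p a b l₁ h₁ l₂ h₂ 0 ω = 0 := by
    rw [Wt, drvProc_zero hWc hp', hW0, sub_zero, hap]
  have hYu : Y u' ω = driver a b X u / L := by
    rw [hYdef, normDrv, hWt, hWt0, sub_zero]
  have hclk : clk 6 p b l₁ h₁ l₂ h₂ u' ω = s := by
    show clockProc (sleW 6) p τ b u' ω = _
    rw [clockProc_eq, hpath, stopT_of_le hu'τ, hu'coe, hcu]
  have hcu' : c u' ω = ((cK * s : ℝ≥0) : ℝ) := by
    rw [hcdef, normClock, hclk, ← hLdef, NNReal.coe_mul, hcKcoe]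
    push_cast
    ring
  -- `M (cK s) = Ỹ_{c u'} = Y_{u'}`
  have hle : cK * s ≤ σc ω := by
    rw [← NNReal.coe_le_coe, hσccoe, totalClock, ← hcu']
    exact hmono ω hu'ρ
  have hM : M (cK * s) (ω, ω') = Y u' ω := by
    have hcat : M (cK * s) (ω, ω') = tcProc Y c ρ (cK * s) ω :=
      @concat_eq_of_le _ (tcProc Y c ρ) σc M hMdef (cK * s) (ω, ω') hle
    rw [hcat]
    have h1 := tcProc_clock (Y := Y) hcc hstrict hnn hu'ρ
    rw [hcu', Real.toNNReal_coe] at h1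
    exact h1
  rw [hU, hM, hYu, mul_div_cancel₀ _ hL.ne']
  rfl

end ImageBM

/-! ### The Möbius map of the statement -/

section Moebius

/-- `Φ_x(z) = xz/(z+x)` is `N(z) = x + x²/(-x - z)` off the pole `-x`. [cite: Lawler2005, §6.3] -/
theorem retargetMoebius_eq_moebN {x : ℝ} {z : ℂ} (hz : z ≠ ((-x : ℝ) : ℂ)) :
    retargetMoebius x z = moebN x (x ^ 2) (-x) z := by
  have h1 : z + x ≠ 0 := by
    intro h
    apply hz
    push_cast
    linear_combination h
  have h2 : ((-x : ℝ) : ℂ) - z ≠ 0 := sub_ne_zero.2 (Ne.symm hz)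
  rw [retargetMoebius, moebN, eq_comm, ← sub_eq_zero]
  push_cast at h2 ⊢
  field_simp
  ring

end Moebius

/-! ### The theorem -/

section Main

/-- A cylinder over the first factor has the measure of its base. [folklore] -/
theorem prod_preimage_fst {Ω : Type*} [MeasurableSpace Ω] (P Q : Measure Ω) [IsProbabilityMeasure Q]
    [SFinite Q] [SFinite P] (S : Set Ω) : (P.prod Q) (Prod.fst ⁻¹' S) = P S := by
  rw [← Set.prod_univ, Measure.prod_prod, measure_univ, mul_one]

/-- **Lawler's locality theorem for SLE₆ in the half-plane** (`sle_six_moebius_locality`): for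
`x ≠ 0` the class of `Φ_x ∘ γ` stopped at `T₋ = firstHit γ (realRay (-x))` and the class of `γ`
stopped at `T₊ = firstHit γ (realRay x)`, `γ` the SLE₆ trace, have the same law. See the module
docstring for the structure of the proof (Lawler's proof of Thm. 6.13 through Prop. 6.14: the
Möbius image chain, Itô's formula at `κ = 6`, the random time change, localised and passed to the
limit). [cite: Lawler2005, §6.3 Thm. 6.13, Prop. 6.14] -/
theorem _root_.Literature.Probability.RandomPlanarGeometry.sle_six_moebius_locality_holds :
    sle_six_moebius_locality := by
  intro x hx T hT
  haveI := isProbabilityMeasure_preWienerMeasure'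
  set P : Measure (ℝ≥0 → ℝ) := preWienerMeasure with hPdef
  -- the Möbius data `N = x + b/(p - ·)`, `x = x`
  set p : ℝ := -x with hpdef
  set b : ℝ := x ^ 2 with hbdef
  have hp : p ≠ 0 := by rw [hpdef]; exact neg_ne_zero.2 hx
  have hb : 0 < b := by rw [hbdef]; positivity
  have hap : x + b / p = 0 := by
    rw [hbdef, hpdef]; field_simp; ring
  have hbp : -(b / p) = x := by
    rw [hbdef, hpdef]; field_simp
  have hba : -(b / x) = p := by
    rw [hbdef, hpdef]; field_simp
  have h60 : (6 : ℝ≥0) ≠ 0 := by norm_num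
  have h68 : (6 : ℝ≥0) ≠ 8 := by norm_num
  have h46 : (4 : ℝ≥0) < 6 := by norm_num
  have h6_8 : (6 : ℝ≥0) < 8 := by norm_num
  -- windows
  set l₁ : ℕ → ℝ := fun n ↦ winLo p n with hl₁
  set h₁ : ℕ → ℝ := fun n ↦ winHi p n with hh₁
  set l₂ : ℕ → ℝ := fun n ↦ winLo x n with hl₂
  set h₂ : ℕ → ℝ := fun n ↦ winHi x n with hh₂
  have hgood : ∀ n, LocGood p b (l₁ n) (h₁ n) (l₂ n) (h₂ n) := fun n ↦ by
    have := locGood_win hp hb n; rwa [hbp] at this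
  have hgood' : ∀ n, LocGood x b (l₂ n) (h₂ n) (l₁ n) (h₁ n) := fun n ↦ by
    have := locGood_win hx hb n; rwa [hba] at this
  have ha_mem : ∀ n, x ∈ Ioo (l₂ n) (h₂ n) := fun n ↦ self_mem_win hx n
  -- almost sure facts on the Wiener space
  have hgen : ∀ᵐ ω ∂P, ∃ γ, IsGeneratedByCurve (sleDriving 6 ω) γ := hasSLETrace_of_ne_eight_apply h68
  have hTp : ∀ᵐ ω ∂P, swallowingTime (sleDriving 6 ω) p < ⊤ := ae_sle_swallowingTime_ofReal_lt_top h46 hp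
  have hTa : ∀ᵐ ω ∂P, swallowingTime (sleDriving 6 ω) x < ⊤ := ae_sle_swallowingTime_ofReal_lt_top h46 hx
  have hpole : ∀ᵐ ω ∂P, (p : ℂ) ∉ range (sleTrace 6 ω) := ae_ofReal_notMem_range_sleTrace h46 h6_8 hp
  -- the random times and classes
  set ρn : ℕ → (ℝ≥0 → ℝ) → ℝ≥0 := fun n ω ↦ (rho 6 p b (l₁ n) (h₁ n) (l₂ n) (h₂ n) ω).untopD 0 with hρn
  set ρn' : ℕ → (ℝ≥0 → ℝ) → ℝ≥0 := fun n ω ↦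
    (locTime (sleW 6) x b (l₂ n) (h₂ n) (l₁ n) (h₁ n) ω).untopD 0 with hρn'
  set Tm : (ℝ≥0 → ℝ) → ℝ≥0 := fun ω ↦ (firstHit (sleTrace 6 ω) (realRay (-x))).untopD 0 with hTm
  set Tp : (ℝ≥0 → ℝ) → ℝ≥0 := fun ω ↦ (firstHit (sleTrace 6 ω) (realRay x)).untopD 0 with hTpdef
  set Zn : ℕ → (ℝ≥0 → ℝ) × (ℝ≥0 → ℝ) → CurveClass ℂ := fun n z ↦
    stoppedPathClass (retargetMoebius x) (sleTrace 6 z.1) (ρn n z.1) with hZn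
  set Zn' : ℕ → (ℝ≥0 → ℝ) × (ℝ≥0 → ℝ) → CurveClass ℂ := fun n z ↦
    stoppedPathClass id (sleTrace 6 z.1) (ρn' n z.1) with hZn'
  set Z : (ℝ≥0 → ℝ) × (ℝ≥0 → ℝ) → CurveClass ℂ := fun z ↦
    stoppedPathClass (retargetMoebius x) (sleTrace 6 z.1) (Tm z.1) with hZ
  set Z' : (ℝ≥0 → ℝ) × (ℝ≥0 → ℝ) → CurveClass ℂ := fun z ↦
    stoppedPathClass id (sleTrace 6 z.1) (Tp z.1) with hZ'
  set μ2 : Measure ((ℝ≥0 → ℝ) × (ℝ≥0 → ℝ)) := P.prod P with hμ2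
  have hfst : Measure.QuasiMeasurePreserving Prod.fst μ2 P := Measure.quasiMeasurePreserving_fst
  set Wp : C(ℝ≥0, ℝ) → ℝ≥0 → ℝ := fun η s ↦ η s - η 0 with hWp
  -- the continuous Möbius image of a good trace, as a continuous map
  have hNγ : ∀ ω, (p : ℂ) ∉ range (sleTrace 6 ω) → (∃ γ, IsGeneratedByCurve (sleDriving 6 ω) γ) →
      ∃ Nγ : C(ℝ≥0, ℂ), (∀ t, moebN x b p (sleTrace 6 ω t) = Nγ t) ∧
        ∀ t, retargetMoebius x (sleTrace 6 ω t) = Nγ t := by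
    intro ω hpo hg
    have hγc : Continuous (sleTrace 6 ω) := (isGeneratedByCurve_trace hg).continuous
    have hne : ∀ t, sleTrace 6 ω t ≠ p := fun t h ↦ hpo ⟨t, h⟩
    have hc : Continuous fun t ↦ moebN x b p (sleTrace 6 ω t) :=
      continuous_iff_continuousAt.2 fun t ↦ (continuousAt_moebN (a := x) (b := b) (hne t)).comp hγc.continuousAt
    refine ⟨⟨_, hc⟩, fun t ↦ rfl, fun t ↦ ?_⟩
    show retargetMoebius x (sleTrace 6 ω t) = moebN x b p (sleTrace 6 ω t)
    rw [hbdef, hpdef]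
    exact retargetMoebius_eq_moebN (hne t)
  -- Step 1: the law identity for every `n`
  have hstep : ∀ n, (AEMeasurable (Zn n) μ2) ∧ (AEMeasurable (Zn' n) μ2) ∧
      ∀ T' : Set (CurveClass ℂ), MeasurableSet T' → μ2 {z | Zn n z ∈ T'} = μ2 {z | Zn' n z ∈ T'} := by
    intro n
    have hg := hgood n
    have hg' := hgood' n
    obtain ⟨Bc, hBcBM, hBcm, hBcc, hagree⟩ := exists_imageBM hg hap
    set U : (ℝ≥0 → ℝ) × (ℝ≥0 → ℝ) → ℝ≥0 → ℝ := fun z s ↦ Real.sqrt 6 * Bc s z with hUdef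
    set Upath : (ℝ≥0 → ℝ) × (ℝ≥0 → ℝ) → C(ℝ≥0, ℝ) := fun z ↦
      (⟨fun t ↦ Real.sqrt 6 * Bc t z, continuous_const.mul (hBcc z)⟩ : C(ℝ≥0, ℝ)) with hUpath
    have hUm : Measurable Upath :=
      Process.measurable_continuousMap_of_eval fun t ↦ (hBcm t).const_mul _
    have hlawU : μ2.map Upath = P.map (drivingPath 6) :=
      map_eq_map_drivingPath 6 exists_isBrownianReal_measurable_continuous_holds hBcBM hBcc hBcm
    set G : C(ℝ≥0, ℝ) → CurveClass ℂ := fun η ↦ stopClass (traceOf η)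
      ((locTime Wp x b (l₂ n) (h₂ n) (l₁ n) (h₁ n) η).untopD 0) with hGdef
    have hGm : Measurable G := measurable_stopClass_traceOf_locTime hg'.h0 hg'.hq
    have hgenU : ∀ᵐ z ∂μ2, ∃ γ', IsGeneratedByCurve (U z) γ' :=
      ae_isGeneratedByCurve_of_isBrownianReal hBcBM hBcc h60 h68
    -- (A) on the product space: `Zn = G ∘ Upath` a.e.
    have hA : ∀ᵐ z ∂μ2, Zn n z = G (Upath z) := by
      filter_upwards [hgenU, hfst.ae hgen, hfst.ae hpole] with z hγ' hgω hpω
      obtain ⟨γ', hγ'⟩ := hγ'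
      set ω := z.1 with hωdef
      have hWc : Continuous (sleW 6 ω) := continuous_sleW ω
      have hW0 : sleW 6 ω 0 = 0 := sleW_zero ω
      have hp' : p ≠ sleW 6 ω 0 := by rw [hW0]; exact hg.q_ne
      -- the finite localisation time
      have hne : rho 6 p b (l₁ n) (h₁ n) (l₂ n) (h₂ n) ω ≠ ⊤ :=
        ne_top_of_le_ne_top WithTop.coe_ne_top (rho_le hg ω)
      obtain ⟨ρ₀, hρ₀⟩ := WithTop.ne_top_iff_exists.1 hne
      have hρ₀' : rho 6 p b (l₁ n) (h₁ n) (l₂ n) (h₂ n) ω = ρ₀ := hρ₀.symm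
      have hρn0 : ρn n ω = ρ₀ := by
        show (rho 6 p b (l₁ n) (h₁ n) (l₂ n) (h₂ n) ω).untopD 0 = ρ₀
        rw [hρ₀', WithTop.untopD_coe]
      have hρT' : (ρ₀ : WithTop ℝ≥0) < swallowingTime (sleW 6 ω) p :=
        coe_rho_lt_swallowingTime hWc hW0 hg hρ₀'
      have hag : ∀ s, s ≤ clockNN (sleW 6 ω) p ρ₀ b ρ₀ → U z s = imageDriver (sleW 6 ω) p ρ₀ x b s :=
        hagree z ρ₀ hρ₀'
      have hUc : Continuous (U z) := continuous_const.mul (hBcc z)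
      -- the curves
      have hγgen : IsGeneratedByCurve (sleW 6 ω) (sleTrace 6 ω) := isGeneratedByCurve_trace hgω
      obtain ⟨Nγ, hNγ, hNγ'⟩ := hNγ ω hpω hgω
      have hne' : ∀ t, sleTrace 6 ω t ≠ p := fun t h ↦ hpω ⟨t, h⟩
      have hγ'U : IsGeneratedByCurve (⇑(Upath z)) γ' := hγ'
      have htr : ⇑(traceOf (Upath z)) = γ' := coe_traceOf_eq hγ'U
      -- the localisation functional on the image path
      have hU0 : U z 0 = 0 := image_zero hWc hW0 hg hρ₀' hag hap
      have hpw : U z = Wp (Upath z) := by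
        funext s
        show U z s = Real.sqrt 6 * Bc s z - Real.sqrt 6 * Bc 0 z
        have : Real.sqrt 6 * Bc 0 z = 0 := hU0
        rw [this, sub_zero]
      have hloc : (locTime Wp x b (l₂ n) (h₂ n) (l₁ n) (h₁ n) (Upath z)).untopD 0 =
          clockNN (sleW 6 ω) p ρ₀ b ρ₀ := by
        rw [← locTime_congr hpw, locTime_image_eq hWc hW0 hg hρ₀' hUc hag hap (ha_mem n),
          WithTop.untopD_coe]
      -- assemble
      show stoppedPathClass (retargetMoebius x) (sleTrace 6 ω) (ρn n ω) =
        stopClass (traceOf (Upath z)) ((locTime Wp x b (l₂ n) (h₂ n) (l₁ n) (h₁ n) (Upath z)).untopD 0)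
      rw [hρn0, hloc, stoppedPathClass_eq_stopClass Nγ hNγ' ρ₀]
      exact stopClass_moebius_eq hWc hp' hρT' hb hUc hag hγgen hγ' hne' Nγ hNγ (traceOf (Upath z))
        (fun t ↦ by rw [htr])
    -- (B) on the Wiener space: `Zn' = G ∘ drivingPath` a.e.
    have hB : ∀ᵐ ω ∂P, stoppedPathClass id (sleTrace 6 ω) (ρn' n ω) = G (drivingPath 6 ω) := by
      filter_upwards [hgen] with ω hgω
      have htr : ⇑(traceOf (drivingPath 6 ω)) = sleTrace 6 ω := coe_traceOf_drivingPath hgω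
      have hpw : sleW 6 ω = Wp (drivingPath 6 ω) := by
        funext s
        show sleDriving 6 ω s = drivingPath 6 ω s - drivingPath 6 ω 0
        rw [coe_drivingPath, sleDriving_zero, sub_zero]
      have hloc : (locTime Wp x b (l₂ n) (h₂ n) (l₁ n) (h₁ n) (drivingPath 6 ω)).untopD 0 = ρn' n ω := by
        rw [← locTime_congr hpw]
      show stoppedPathClass id (sleTrace 6 ω) (ρn' n ω) =
        stopClass (traceOf (drivingPath 6 ω))
          ((locTime Wp x b (l₂ n) (h₂ n) (l₁ n) (h₁ n) (drivingPath 6 ω)).untopD 0)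
      rw [hloc, stoppedPathClass_eq_stopClass (traceOf (drivingPath 6 ω)) (fun t ↦ by rw [htr]; rfl)]
    have hB2 : ∀ᵐ z ∂μ2, Zn' n z = G (drivingPath 6 z.1) := hfst.ae hB
    refine ⟨⟨G ∘ Upath, hGm.comp hUm, hA⟩,
      ⟨fun z ↦ G (drivingPath 6 z.1), hGm.comp ((measurable_drivingPath 6).comp measurable_fst), hB2⟩,
      fun T' hT' ↦ ?_⟩
    have hGT : MeasurableSet {η | G η ∈ T'} := hGm hT'
    calc μ2 {z | Zn n z ∈ T'} = μ2 {z | G (Upath z) ∈ T'} := by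
          refine measure_congr ?_
          filter_upwards [hA] with z hz
          show (Zn n z ∈ T') = (G (Upath z) ∈ T')
          rw [hz]
      _ = μ2.map Upath {η | G η ∈ T'} := (Measure.map_apply hUm hGT).symm
      _ = P.map (drivingPath 6) {η | G η ∈ T'} := congrArg (fun ν : Measure C(ℝ≥0, ℝ) ↦ ν {η | G η ∈ T'}) hlawU
      _ = P {ω | G (drivingPath 6 ω) ∈ T'} := Measure.map_apply (measurable_drivingPath 6) hGT
      _ = P {ω | stoppedPathClass id (sleTrace 6 ω) (ρn' n ω) ∈ T'} := by
          refine measure_congr ?_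
          filter_upwards [hB] with ω hω
          show (G (drivingPath 6 ω) ∈ T') = (stoppedPathClass id (sleTrace 6 ω) (ρn' n ω) ∈ T')
          rw [hω]
      _ = μ2 {z | Zn' n z ∈ T'} := (prod_preimage_fst P P _).symm
  -- Step 2: the almost sure limits
  have hlim1 : ∀ᵐ ω ∂P, Tendsto (fun n ↦ stoppedPathClass (retargetMoebius x) (sleTrace 6 ω) (ρn n ω))
      atTop (𝓝 (stoppedPathClass (retargetMoebius x) (sleTrace 6 ω) (Tm ω))) := by
    filter_upwards [hgen, hTp, hpole] with ω hgω hTω hpω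
    obtain ⟨Nγ, -, hNγ'⟩ := hNγ ω hpω hgω
    have hWc : Continuous (sleW 6 ω) := continuous_sleW ω
    have hW0 : sleW 6 ω 0 = 0 := sleW_zero ω
    have hconv := tendsto_untopD_locTime_win (W := sleW 6) (b := b) hWc hW0 hp hb hTω
    rw [hbp] at hconv
    have hfh : (swallowingTime (sleW 6 ω) p).untopD 0 = Tm ω := by
      show (swallowingTime (sleDriving 6 ω) p).untopD 0 = (firstHit (sleTrace 6 ω) (realRay (-x))).untopD 0
      rw [sle_swallowingTime_ofReal_eq_firstHit_holds 6 ω (isGeneratedByCurve_trace hgω) hp]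
      rfl
    rw [hfh] at hconv
    simp only [stoppedPathClass_eq_stopClass Nγ hNγ']
    exact tendsto_stopClass hconv
  have hlim : ∀ᵐ z ∂μ2, Tendsto (fun n ↦ Zn n z) atTop (𝓝 (Z z)) := hfst.ae hlim1
  have hlim1' : ∀ᵐ ω ∂P, Tendsto (fun n ↦ stoppedPathClass id (sleTrace 6 ω) (ρn' n ω))
      atTop (𝓝 (stoppedPathClass id (sleTrace 6 ω) (Tp ω))) := by
    filter_upwards [hgen, hTa] with ω hgω hTω
    have hWc : Continuous (sleW 6 ω) := continuous_sleW ω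
    have hW0 : sleW 6 ω 0 = 0 := sleW_zero ω
    have hconv := tendsto_untopD_locTime_win (W := sleW 6) (b := b) hWc hW0 hx hb hTω
    rw [hba] at hconv
    have hγc : Continuous (sleTrace 6 ω) := (isGeneratedByCurve_trace hgω).continuous
    set γc : C(ℝ≥0, ℂ) := ⟨sleTrace 6 ω, hγc⟩ with hγcdef
    have hfh : (swallowingTime (sleW 6 ω) x).untopD 0 = Tp ω := by
      show (swallowingTime (sleDriving 6 ω) x).untopD 0 = (firstHit (sleTrace 6 ω) (realRay x)).untopD 0
      rw [sle_swallowingTime_ofReal_eq_firstHit_holds 6 ω (isGeneratedByCurve_trace hgω) hx]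
      rfl
    rw [hfh] at hconv
    simp only [stoppedPathClass_eq_stopClass (F := id) (γ₀ := sleTrace 6 ω) γc (fun t ↦ rfl)]
    exact tendsto_stopClass hconv
  have hlim' : ∀ᵐ z ∂μ2, Tendsto (fun n ↦ Zn' n z) atTop (𝓝 (Z' z)) := hfst.ae hlim1'
  -- Step 3: identification of the limit laws, and back to the Wiener space
  have key := measure_setOf_mem_eq_of_tendsto_ae (P := μ2) (fun n ↦ (hstep n).1) (fun n ↦ (hstep n).2.1)
    (fun n T' hT' ↦ (hstep n).2.2 T' hT') hlim hlim' hT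
  have h1 := prod_preimage_fst P P {ω | stoppedPathClass (retargetMoebius x) (sleTrace 6 ω) (Tm ω) ∈ T}
  have h2 := prod_preimage_fst P P {ω | stoppedPathClass id (sleTrace 6 ω) (Tp ω) ∈ T}
  rw [← h1, ← h2]
  exact key

end Main

end MoebiusPole

end Literature.Probability.RandomPlanarGeometry
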